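import Summits.ValiantsHypothesis.ValiantsHypothesis.Theses.UlrichPadded
import Literature.Computability.AlgebraicComplexity.PermanentIrreducible
import Literature.LinearAlgebra.Matrix.PermanentSubperm
import Literature.Computability.AlgebraicComplexity.VonZurGathenSingPermHeight
import Literature.AlgebraicGeometry.Resolution.RegularLocalRingsUFD

/-!
# Disproof of `PermHypersurfaceFactorial` — findings (standing disprover, generations 2–3)

Crux `stmt-ValiantsHypothesis-5666` = `UlrichPadded.PermHypersurfaceFactorial`:
`∀ n ≥ 3, ∀ P : Ideal (ℂ[x_ij] ⧸ (per_n)), P.IsPrime → P.height = 1 → P.IsPrincipal`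
("`S_n = ℂ[x]/(per_n)` is factorial", read back in `crux_iff`; for the noetherian domain `S_n`
this is `Cl(S_n) = 0`).

## VERDICT (2026-08-15 gen-2; re-examined 2026-08-16 gen-3): the crux RESISTS — it is a theorem
modulo Lean assembly, along three independent lines, and no regime / model / dropped input breaks it.

### Gen-3 (2026-08-16) additions — all PROVED below (0 sorry, standard axioms), see §§9–11
* `crux ⟺ ∀ n ≥ 3, H(n)` is now understood in BOTH directions (paper, recorded for the provers):
  ⟸ is the Nagata line; ⟹: `c̄ = per x(0|0)` is irreducible in the graded domain `S_n` (a
  factorisation would be homogeneous of degrees `d, n-1-d ≥ 1` and lift to `ℂ[x]`, where `c` is an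
  irreducible `per_{n-1}`), so `S_n` UFD ⇒ `c̄` prime ⇒ `(per_n, c) = (c₀, Σ_{j≥1} x₀ⱼcⱼ)` prime ⇒
  `ht(c₀,…,c_{n-1}) ≥ 3` (if a height-2 prime `𝔓 ⊇ (c₀..c_{n-1})` existed, `V(𝔓/(c₀)) × 𝔸ⁿ⁻¹` would be a
  second component of `V(Σ ℓⱼvⱼ)` of full dimension).  So a failure of H(n) at ANY `n` would refute
  the crux — this is the one integer-valued attack surface, and it holds as far as computed:
* EXACT CERTIFICATES (this session, `jobs/h3cert/main.py`, kit job j007676 for the evidence trail;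
  locally reproduced in seconds): H3(n) — already the three maximal subpermanents deleting columns
  `0,1,2` of a generic `(n-1) × n` matrix have height `≥ 3` — for EVERY `3 ≤ n ≤ 14`
  (cone section by one explicit 3-plane, mod `p = 2³¹-1`, lifted to `ℚ̄`/`ℂ` by properness of
  `Proj → Spec ℤ`; the determinant control DET3 fails to certify at every `n`, gcd degree
  `3, 6, 10, …` = the height-2 component, as it must).  H3(n) for all `n` has a two-case induction
  (CASE A: off `{ζ = 0}` the locus `V(P₀,P₁)` is a rank-2 bundle, irreducible of codim 2, on which
  `P₂ ≢ 0` by the `2ab ≠ 0` point — HERE `2 ≠ 0`; CASE B: `{ζ = 0}` is the size-`n-1` instance,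
  transposed) that this disprover could not fault; base `n = 3` is the `2 × 3` computation (codim 3).
* (a) completed: `permHypersurfaceFactorial_false_without_isPrime` (§10) — dropping `P.IsPrime` is
  fatal at `n = 3` (`x̄₀₀·𝔪` has height 1, is not principal); with gen-2's `_without_three_le` and
  `_without_heightOne` every hypothesis of the crux is now certified load-bearing.
* THE VERTEX (§9): `(S_2)_𝔪` is NOT a UFD (`not_ufm_loc_two`: a prime factor of `x̄₀₀` would divide
  `x̄₀₁` or `x̄₁₀`; localised dual-number probes `tangL`) and NOT regular
  (`not_isRegularLocalRing_loc_two`, via the tree's Auslander–Buchsbaum); every prime of `S_2` has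
  height `≤ 3` (`height_le_three_two`, `dim S_2 + 1 ≤ dim ℂ[x_{2×2}] = 4`).
* TARGETS = the lead's picked line `derivation-symbolic-square` (§11, stubs read back literally in
  `stubs_readback`): all four stubs are true for `n ≥ 3`; at `n = 2` EXACTLY `stub_missingPartial`
  fails (`missingPartialAt_two_false`: the vertex is a height-≤3 prime containing every partial),
  while `stub_localFactorial` and `stub_gradedDescent` HOLD at `n = 2` vacuously (`localFactorialAt_two`,
  `gradedDescentAt_two`) with FALSE conclusions (`…_conclusion_false`): the guard `3 ≤ n` enters this
  line only through von zur Gathen's bound — `pickedLine_guard_profile_at_two`.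
* THE FIELD IS LOAD-BEARING (§14, the one hypothesis of the crux not yet certified): over ANY field
  of characteristic two the crux's statement is FALSE at `n = 3` —
  `not_ufm_S_three_charTwo : ¬ UniqueFactorizationMonoid (S K 3)` (`[CharP K 2]`, e.g. `𝔽₂`) and
  `permHypersurfaceFactorialOver_false_of_charTwo`.  Witness: the determinantal prime
  `P = I₂(rows 1,2)/(per₃) = ker(S_3 → K[x], rows 1,2 ↦ s·v, t·v)`; `ht P ≤ 1` by seven kernels above it;
  NOT principal by a second-order tangent obstruction (two-jets `x_p ↦ a_p ε + b_p η` into `K[η][ε]`: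
  a generator `g` would make the polar forms of the three `2 × 2` subpermanents of rows `1,2` either
  all proportional (`dg(0) = 0`) or all isotropic on `ker dg(0)` (`dg(0) ≠ 0`) — both excluded by
  explicit tangent pairs).  So `2 ≠ 0` enters the CRUX, not only vzG's lemma / lemma A of the ladder;
  this is the formal content of barrier `PermanentCharTwo` at the class-group level (Cl(det₃) ≠ 0).
* THRESHOLD WINDOW of `stub_missingPartial` (§13, the lead's exact currency): the prime
  `(x̄_0•, x̄_1•) ⊂ S_n` (kernel of "kill rows 0,1") contains every partial and has height `≤ 2n-1`
  (a chain of `n²-2n` kernels above it + `dim S_n ≤ n²-1`), so `MissingPartialAtHeight n (2n-1)` is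
  FALSE for every `n ≥ 2` (`missingPartialAtHeight_false`); at `n = 3` the threshold `k` of the stub
  satisfies: `k = 3` true (vzG, as filed), `k = 5` false (`missingPartialAtHeight_three_five_false`),
  `k = 4` true only via Laubenbacher–Swanson (not in tree) — do not restate the stub with `dim - 4`.
* Competing lines audited on paper (no Lean kill possible, all stubs true): nagata-corner-subpermanent
  — `HomogeneousRegularThree` (Macaulay unmixedness for three forms; homogeneity needed only because the
  ORDER is fixed: `(xz, yz, z-1)` fails but `(z-1, xz, yz)` is regular), `LinearFormPrime` (true over
  any domain, McCoy + inverting `a_{j₁}`; the regularity of `a_{j₂}` mod `a_{j₁}` cannot be dropped: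
  `t·y₀ + t·y₁`), `CornerPrimeTransfer` (flatness of `B ⊂ B[x₀•]` transfers the regular sequence),
  `RowSubpermHeightThree` = H3(n) above — the two relaxations are REFUTED formally in §12
  (`regularThree_false_without_homogeneous`: `(x(z+1), y(z+1), z)`; `linearFormPrime_false_without_regular`:
  `t·y₀ + t·y₁` over `ℚ[t]`); subpermanent-height-three-nagata — `stub_unmixedHeightTwo` is
  CM unmixedness of a height-2 complete intersection (true WITHOUT homogeneity), H(n) ⇐ H3(n).


Two independent printed proof lines, every non-elementary input of which is now in the tree:
* SGA2 line (route plan): `perPoly_irreducible` (domain) + `vonzurGathen1987_singPerm_height_holds`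
  (PROVED: primes over `(per_n, ∂per_n)` have height ≥ 5 in `K[x]`, `n ≥ 3`, `2 ≠ 0`) ⇒ `S_n`
  regular in codimension ≤ 3 ⇒ (`Grothendieck1968_samuelConjecture_hypersurface`, SGA2 XI 3.14
  for `R/(f)`, `R` regular LOCAL, `f ∈ 𝔪_R` — read: correctly stated (a GLOBAL version would be
  false: `ℂ[x,y,z]/(xy - z² + 1)` is regular with `Cl = ℤ`), and since 2026-08-15 PROVED in tree,
  `Grothendieck1968_samuelConjecture_hypersurface_holds`, GrothendieckSamuelHypersurfaceKernel.lean,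
  0 sorry) `(S_n)_𝔪` factorial at every maximal `𝔪` ⇒
  (`Fossum1973_graded_factorial_iff_atIrrelevant_holds`, PROVED in tree) `S_n` factorial.
  Open plumbing only: regularity at primes off the singular locus (derivation test: a missing
  partial puts `per_n ∉ 𝔮²R_𝔮`), the grading of the quotient, `S_𝔪 ≅ ℂ[x]_𝔪/(per_n)`, height
  bookkeeping `ht(𝔮/(per)) ≤ 3 ⇒ ht 𝔮 ≤ 4`.
* Nagata line (crux idea cards `subpermanent-height-three-nagata`, `nagata-laplace-ladder`):
  `S_n[1/per(x(0|0))]` is a localised polynomial ring (solve for `x₀₀`), so by Nagata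
  `S_n` is a UFD iff the cofactor `per(x(0|0))` is a prime ELEMENT of `S_n`, which holds iff
  H(n): the `n` maximal subpermanents of a generic `(n-1) × n` matrix generate an ideal of height
  ≥ 3 (symmetric algebra of a pd-1 module; Samuel/Vasconcelos).  H(n) certified exactly for
  `n ≤ 7` (ideator job j004945) and `n ≤ 10` attempted here (job j006243, 3-plane cone sections).

Nothing in print or in the negatives index contradicts factoriality for `n ≥ 3`; searched:
`lit search` "permanent hypersurface coordinate ring factorial / class group" (searchd degraded this
session, retried), ledger negatives (4 items, none on factoriality/heights).

## What is PROVED in this file (sorry-free, axioms ⊆ {propext, Classical.choice, Quot.sound})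

(a) load-bearing hypotheses — any proof must use them:
* `permHypersurfaceFactorial_false_without_three_le` : with `2 ≤ n` the crux is FALSE.  Witness
  `n = 2`, `P₂ = (x̄₀₀, x̄₀₁) ⊂ S_2`: prime (`ker` of kill-row-0, `ker_psi`), height one
  (`height_P₂`: Krull's PIT over `(x̄₀₀)` + `x̄₀₁x̄₁₀ = -x̄₀₀x̄₁₁` + `S_2` a domain), not principal
  (`P₂_not_isPrincipal`, tangent obstruction).  `factorialAt_two_false : ¬ FactorialAt 2`.
* `permHypersurfaceFactorial_false_without_heightOne` : dropping `P.height = 1` is fatal at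
  `n = 3` (and every `n ≥ 2`, `exists_isPrime_not_isPrincipal`): the irrelevant ideal is prime,
  not principal.
(b) the tangent obstruction `not_isPrincipal_of_xbar_mem` (reusable): for `n ≥ 2` an ideal of
  `S_n` inside `(x̄)` containing two distinct variables is not principal (dual-number probes
  `tang : S_n →ₐ K[ε]`, Leibniz rule `snd_tang_mul`).
(b') TIGHTNESS of the codimension input (§8): `singPerm_height_window` — for every `n ≥ 3` a
  prime over `singPermIdeal ℂ n` of height in `[5, 2n]` (lower: vzG tree theorem; upper: the
  witness `(x_0•, x_1•)`, Krull); `singPerm_height_window_three` — at `n = 3` the window is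
  `[5, 6]`, so vzG has at most one unit of slack there and `S_3` is `R₄` but not `R₅`;
  `singPermHeightFive_false_without_three_le` — vzG's own guard `3 ≤ m` is necessary (`m = 2`:
  height ≤ 4).  Small cases: `factorialAt_iff_ne_two_of_le_two` (`FactorialAt n ↔ n ≠ 2`, n ≤ 2).
(c) natural companion statements that FAIL (edges of the ideators' levers; all NEW in gen-2):
* `cofactor_not_prime_two` / `span_per_cofactor_not_isPrime_two` : lemma A of the Nagata ladder
  ("`per(x(0|0))` is prime in `S_n`") is false at `n = 2` (`x̄₁₁ ∣ x̄₀₁x̄₁₀`).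
* `span_det_cofactor_not_isPrime_three`, `det_cofactor_not_prime_three` : for `det_3` the cofactor
  `x₁₁x₂₂ - x₁₂x₂₁` is NOT prime modulo `det_3` — explicit `a b ∈ (det_3, cofactor)`, `a, b ∉`;
  this is the height-TWO phenomenon (`Cl(K[x]/det) = ℤ`) that H(n) ≥ 3 rules out for `per`.
* `span_per_cofactor_not_isPrime_three_charTwo` : in characteristic 2 (`per_3 = det_3`,
  `perPoly_three_eq_detPoly_of_charTwo`) lemma A fails verbatim at `n = 3`: `2 ≠ 0` is load-bearing
  for the ladder, consistent with `Literature.Barriers.ValiantsHypothesis.PermanentCharTwo`.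
* `rowPartialsHeightThree_false_at_two` : H(2) is false (the row-0 partials of `per_2` lie in the
  height-2 prime `(x₁₀, x₁₁)`), so the height-three lever needs `3 ≤ n` exactly like the crux.

## Attempts that did NOT break the crux (why it resists)
* degenerate `n`: `n = 0` (`S_0 = 0`, no primes) and `n = 1` (`S_1 ≅ ℂ`) are vacuous; `n = 2`
  fails but is excluded by the guard; `n = 3`: Sing V(per_3) = V(2×2 subpermanents) has codim 6
  (Laubenbacher–Swanson components: one row / one column / 2×2 anti-rank-one block), R₄ holds.
* vendored-fact audit: SGA2 XI 3.14 is stated for LOCAL complete intersections and is now proved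
  in tree; Fossum 10.3 is proved; vzG Lemma 2.3 is proved (explicit chains, 0 sorry).  No
  mis-stated or unproved input is left on the SGA2 line — only plumbing.
* formal junk: `Ideal.height` of a prime = `primeHeight` (ℕ∞), `⊤` excluded by `IsPrime`,
  `Submodule.IsPrincipal` = one generator; quotient by `Ideal.span {perPoly}` with
  `perPoly = (mvPolynomialX).permanent = Σ_σ Π_i X (σ i, i)`; nothing vacuous, nothing junk.
* small-model computation (exact cone sections, this session): jobs j006243 (H(n), n ≤ 10),
  j006245 (codim Sing V(per_4) ≥ k, k = 5..8), j006248 (codim Sing V(per_5) ≥ k, k = 5..7) —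
  results recorded in the crux NOTES / evidence when they land; any FAILURE of H(n) would refute
  the crux outright (factorial ⟺ H(n)), any success is slack for the provers.

## For the provers (learnings)
* The per/det separation used by BOTH lines is one integer: `ht(maximal subpermanents of an
  (n-1)×n matrix)` = 3⁺ for per (n ≥ 3, char ≠ 2) versus 2 for det / char 2 / n = 2 — see the
  three `…not_isPrime…` theorems for the exact failure pattern (a second component of
  `V(f, cofactor)` of the same dimension).
* `S_n` is never a PID-like ring: the irrelevant ideal needs `n²` generators; only HEIGHT-ONE
  primes are claimed principal — keep `P.height = 1` in every intermediate statement.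

Gen-1 (`refuter-cdisprove-stmt-ValiantsHypothesis-5666-0`, evidence `Disproof.lean` sha256
ec5e4f8f…, 521 lines) proved (a) and the `n ≤ 2` characterisation first; that file is not mounted
in later jails, so (a),(b) are re-derived here independently and (c) is new.
-/

noncomputable section

set_option linter.dupNamespace false

namespace Summit.ValiantsHypothesis.ValiantsHypothesis.Cruxes.PermHypersurfaceFactorial.Disproof

open MvPolynomial Literature.Computability.AlgebraicComplexity
open scoped DualNumber

/-! ## 0. Notation and read-back of the crux -/

/-- The polynomial ring `K[x_ij]`, `i, j < n`. [folklore] -/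
abbrev R (K : Type*) [CommRing K] (n : ℕ) : Type _ := MvPolynomial (Fin n × Fin n) K

/-- The principal ideal `(per_n)`. [folklore] -/
abbrev perIdeal (K : Type*) [CommRing K] (n : ℕ) : Ideal (R K n) := Ideal.span {perPoly (Fin n) K}

/-- The permanental hypersurface ring `S_n = K[x_ij]/(per_n)`. [folklore] -/
abbrev S (K : Type*) [CommRing K] (n : ℕ) : Type _ := R K n ⧸ perIdeal K n

/-- The image `x̄_p` of a variable in `S_n`. [folklore] -/
abbrev xbar (K : Type*) [CommRing K] {n : ℕ} (p : Fin n × Fin n) : S K n :=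
  Ideal.Quotient.mk (perIdeal K n) (X p)

/-- The conclusion of the crux at ONE `n` (over `ℂ`): every height-one prime of `S_n` is
principal. [folklore] -/
def FactorialAt (n : ℕ) : Prop :=
  ∀ P : Ideal (S ℂ n), P.IsPrime → P.height = 1 → P.IsPrincipal

/-- Read-back: the crux is `∀ n ≥ 3, FactorialAt n`, definitionally. [folklore] -/
theorem crux_iff :
    Summit.ValiantsHypothesis.ValiantsHypothesis.Theses.UlrichPadded.PermHypersurfaceFactorial ↔
      ∀ n : ℕ, 3 ≤ n → FactorialAt n :=
  Iff.rfl

/-- `per_n` is a prime polynomial for `n ≥ 1` (vzG Thm 3.4, tree `perPoly_irreducible`, + Gauss).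
[folklore] -/
theorem perPoly_prime (K : Type*) [Field K] {n : ℕ} (hn : 1 ≤ n) : Prime (perPoly (Fin n) K) := by
  haveI : Nonempty (Fin n) := ⟨⟨0, hn⟩⟩
  exact UniqueFactorizationMonoid.irreducible_iff_prime.mp perPoly_irreducible

/-- `S_n` is an integral domain for `n ≥ 1`. [folklore] -/
theorem isDomain_S (K : Type*) [Field K] {n : ℕ} (hn : 1 ≤ n) : IsDomain (S K n) := by
  haveI : (perIdeal K n).IsPrime :=
    (Ideal.span_singleton_prime (perPoly_prime K hn).ne_zero).mpr (perPoly_prime K hn)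
  exact Ideal.Quotient.isDomain _

/-- **No junk in the formal statement:** for `n ≥ 1`, `FactorialAt n` is literally
"`S_n` is a UFD" (Mathlib `UniqueFactorizationMonoid.iff_forall_isPrincipal_of_height_eq_one`,
Stacks 0AFT, for the noetherian domain `S_n`). [folklore] -/
theorem factorialAt_iff_ufm {n : ℕ} (hn : 1 ≤ n) :
    FactorialAt n ↔ UniqueFactorizationMonoid (S ℂ n) := by
  haveI := isDomain_S ℂ hn
  rw [UniqueFactorizationMonoid.iff_forall_isPrincipal_of_height_eq_one]
  exact ⟨fun h p hp hh => h p hp hh, fun h p hp hh => @h p hp hh⟩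

/-- The crux, read back: `S_n = ℂ[x_ij]/(per_n)` is a UFD for every `n ≥ 3`. [folklore] -/
theorem crux_iff_ufm :
    Summit.ValiantsHypothesis.ValiantsHypothesis.Theses.UlrichPadded.PermHypersurfaceFactorial ↔
      ∀ n : ℕ, 3 ≤ n → UniqueFactorizationMonoid (S ℂ n) :=
  forall₂_congr fun _ hn => factorialAt_iff_ufm (by omega)

/-! ## 1. Explicit small permanents / determinants -/

section Explicit

variable (K : Type*) [CommRing K]

/-- `per_2 = x₀₀ x₁₁ + x₀₁ x₁₀`. [folklore] -/
theorem perPoly_two : perPoly (Fin 2) K = X (0, 0) * X (1, 1) + X (0, 1) * X (1, 0) := by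
  simp [perPoly, Matrix.permanent_fin_two_row, Matrix.mvPolynomialX]

/-- `per_3`, expanded along row `0`. [folklore] -/
theorem perPoly_three : perPoly (Fin 3) K =
    X (0, 0) * (X (1, 1) * X (2, 2) + X (1, 2) * X (2, 1)) +
      X (0, 1) * (X (1, 0) * X (2, 2) + X (1, 2) * X (2, 0)) +
        X (0, 2) * (X (1, 0) * X (2, 1) + X (1, 1) * X (2, 0)) := by
  simp [perPoly, Matrix.permanent_fin_three_row, Matrix.mvPolynomialX]

/-- `det_3`, expanded. [folklore] -/
theorem detPoly_three : detPoly (Fin 3) K =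
    X (0, 0) * X (1, 1) * X (2, 2) - X (0, 0) * X (1, 2) * X (2, 1)
      - X (0, 1) * X (1, 0) * X (2, 2) + X (0, 1) * X (1, 2) * X (2, 0)
        + X (0, 2) * X (1, 0) * X (2, 1) - X (0, 2) * X (1, 1) * X (2, 0) := by
  simp [detPoly, Matrix.det_fin_three, Matrix.mvPolynomialX]

end Explicit

/-! ## 2. Two elementary tools: non-membership by evaluation, divisibility in a quotient -/

section Tools

variable {K : Type*} [CommRing K] {σ : Type*}

/-- A polynomial is outside `span s` as soon as some evaluation kills `s` but not it. [folklore] -/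
theorem not_mem_span_of_eval (v : σ → K) {s : Set (MvPolynomial σ K)} {f : MvPolynomial σ K}
    (hs : ∀ g ∈ s, eval v g = 0) (hf : eval v f ≠ 0) : f ∉ Ideal.span s := by
  intro h
  have hle : Ideal.span s ≤ RingHom.ker (eval v) :=
    Ideal.span_le.mpr fun g hg => (RingHom.mem_ker).mpr (hs g hg)
  exact hf ((RingHom.mem_ker).mp (hle h))

/-- In `A/(f)`: if `p̄ ∣ ā` then `a ∈ (f, p)`. [folklore] -/
theorem mem_span_pair_of_mk_dvd {A : Type*} [CommRing A] {f p a : A}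
    (h : Ideal.Quotient.mk (Ideal.span {f}) p ∣ Ideal.Quotient.mk (Ideal.span {f}) a) :
    a ∈ Ideal.span {f, p} := by
  obtain ⟨c, hc⟩ := h
  obtain ⟨q, rfl⟩ := Ideal.Quotient.mk_surjective c
  rw [← map_mul, eq_comm, Ideal.Quotient.eq, Ideal.mem_span_singleton'] at hc
  obtain ⟨r, hr⟩ := hc
  rw [Ideal.mem_span_pair]
  exact ⟨-r, q, by linear_combination -hr⟩

/-- In `A/(f)`: if `a ∈ (f, p)` then `p̄ ∣ ā`. [folklore] -/
theorem mk_dvd_of_mem_span_pair {A : Type*} [CommRing A] {f p a : A}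
    (h : a ∈ Ideal.span {f, p}) :
    Ideal.Quotient.mk (Ideal.span {f}) p ∣ Ideal.Quotient.mk (Ideal.span {f}) a := by
  rw [Ideal.mem_span_pair] at h
  obtain ⟨r, s, rfl⟩ := h
  refine ⟨Ideal.Quotient.mk _ s, ?_⟩
  rw [← map_mul, eq_comm, Ideal.Quotient.eq, Ideal.mem_span_singleton']
  exact ⟨-r, by ring⟩

end Tools

/-! ## 3. (c) Natural companion statements that FAIL: the Nagata-ladder lemma at `n = 2`,
the determinant at `n = 3`, and the permanent at `n = 3` in characteristic two -/

section LadderEdges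

variable (K : Type*) [CommRing K] [Nontrivial K]

/-- **Lemma A of the Nagata ladder is false at `n = 2`.** In `S_2 = K[x]/(x₀₀x₁₁ + x₀₁x₁₀)` the
cofactor `x̄₁₁ = per(x(0|0))` is NOT a prime element: `x̄₁₁ ∣ x̄₀₁ · x̄₁₀ = -x̄₀₀ x̄₁₁` but
`x̄₁₁ ∤ x̄₀₁`, `x̄₁₁ ∤ x̄₁₀` (evaluate at the coordinate points `e₀₁`, `e₁₀`).  So the ideators'
`MinorPrimeModPer` / `CofactorPrime` (stated with `3 ≤ n`) cannot be relaxed to `2 ≤ n`, matching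
`Cl(S_2) = ℤ`. [folklore] -/
theorem cofactor_not_prime_two : ¬ Prime (xbar K ((1, 1) : Fin 2 × Fin 2)) := by
  intro h
  have hdvd : xbar K ((1, 1) : Fin 2 × Fin 2) ∣ xbar K (0, 1) * xbar K (1, 0) := by
    rw [xbar, xbar, ← map_mul]
    apply mk_dvd_of_mem_span_pair
    rw [Ideal.mem_span_pair, perPoly_two]
    exact ⟨1, -X (0, 0), by ring⟩
  rcases h.2.2 _ _ hdvd with h1 | h1
  · have := mem_span_pair_of_mk_dvd h1
    refine not_mem_span_of_eval (fun p => if p = (0, 1) then 1 else 0) ?_ ?_ this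
    · intro g hg
      rcases hg with rfl | rfl
      · simp [perPoly_two]
      · simp
    · simp
  · have := mem_span_pair_of_mk_dvd h1
    refine not_mem_span_of_eval (fun p => if p = (1, 0) then 1 else 0) ?_ ?_ this
    · intro g hg
      rcases hg with rfl | rfl
      · simp [perPoly_two]
      · simp
    · simp

/-- Ideal form of the same edge: `(per_2, x₁₁)` is not a prime ideal of `K[x]`. [folklore] -/
theorem span_per_cofactor_not_isPrime_two :
    ¬ (Ideal.span {perPoly (Fin 2) K, X (1, 1)}).IsPrime := by
  intro h
  have hmem : X (0, 1) * X (1, 0) ∈ Ideal.span {perPoly (Fin 2) K, X (1, 1)} := by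
    rw [Ideal.mem_span_pair, perPoly_two]
    exact ⟨1, -X (0, 0), by ring⟩
  rcases h.mem_or_mem hmem with h1 | h1
  · refine not_mem_span_of_eval (fun p => if p = (0, 1) then 1 else 0) ?_ ?_ h1
    · intro g hg
      rcases hg with rfl | rfl
      · simp [perPoly_two]
      · simp
    · simp
  · refine not_mem_span_of_eval (fun p => if p = (1, 0) then 1 else 0) ?_ ?_ h1
    · intro g hg
      rcases hg with rfl | rfl
      · simp [perPoly_two]
      · simp
    · simp

/-- The cofactor `x₁₁x₂₂ - x₁₂x₂₁` of `x₀₀` in `det_3`. [folklore] -/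
def detCofactor₃ : R K 3 := X (1, 1) * X (2, 2) - X (1, 2) * X (2, 1)

/-- **The mechanism is per-specific: for the DETERMINANT the cofactor is not prime.**
In `K[x]` (`3 × 3`), the ideal `(det_3, x₁₁x₂₂ - x₁₂x₂₁)` is not prime: with
`a = x₁₀x₂₁ - x₁₁x₂₀` (vanishes on the extra component `rank(rows 1,2) ≤ 1`) and
`b = x₀₁x₁₂ - x₀₂x₁₁` (vanishes on the main component) one has
`a b = -x₁₁ · det_3 + (x₀₀x₁₁ - x₀₁x₁₀) · (x₁₁x₂₂ - x₁₂x₂₁)` while `a, b ∉ (det_3, cofactor)`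
(coordinate points).  This is the height-two phenomenon (`Cl(K[x]/det) = ℤ`, Bruns–Vetter) that the
permanent avoids for `n ≥ 3` (its maximal subpermanents have height ≥ 3, ideator card
`subpermanent-height-three-nagata`, H(n)). [folklore] -/
theorem span_det_cofactor_not_isPrime_three :
    ¬ (Ideal.span {detPoly (Fin 3) K, detCofactor₃ K}).IsPrime := by
  intro h
  have hmem : (X (1, 0) * X (2, 1) - X (1, 1) * X (2, 0)) * (X (0, 1) * X (1, 2) - X (0, 2) * X (1, 1))
      ∈ Ideal.span {detPoly (Fin 3) K, detCofactor₃ K} := by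
    rw [Ideal.mem_span_pair, detPoly_three, detCofactor₃]
    exact ⟨-X (1, 1), X (0, 0) * X (1, 1) - X (0, 1) * X (1, 0), by ring⟩
  rcases h.mem_or_mem hmem with h1 | h1
  · -- the point x₁₀ = x₂₁ = 1, all other coordinates 0
    refine not_mem_span_of_eval (fun p => if p = (1, 0) ∨ p = (2, 1) then 1 else 0) ?_ ?_ h1
    · intro g hg
      rcases hg with rfl | rfl
      · simp [detPoly_three]
      · simp [detCofactor₃]
    · simp
  · -- the point x₁₁ = x₂₁ = x₀₂ = 1, all other coordinates 0
    refine not_mem_span_of_eval (fun p => if p = (1, 1) ∨ p = (2, 1) ∨ p = (0, 2) then 1 else 0)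
      ?_ ?_ h1
    · intro g hg
      rcases hg with rfl | rfl
      · simp [detPoly_three]
      · simp [detCofactor₃]
    · simp

/-- Element form: the image of the cofactor in `K[x]/(det_3)` is not a prime element. [folklore] -/
theorem det_cofactor_not_prime_three :
    ¬ Prime (Ideal.Quotient.mk (Ideal.span {detPoly (Fin 3) K}) (detCofactor₃ K)) := by
  intro h
  apply span_det_cofactor_not_isPrime_three K
  have hI : Ideal.span {detPoly (Fin 3) K, detCofactor₃ K} =
      (Ideal.span {Ideal.Quotient.mk (Ideal.span {detPoly (Fin 3) K}) (detCofactor₃ K)}).comap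
        (Ideal.Quotient.mk (Ideal.span {detPoly (Fin 3) K})) := by
    ext a
    simp only [Ideal.mem_comap, Ideal.mem_span_singleton]
    exact ⟨mk_dvd_of_mem_span_pair, mem_span_pair_of_mk_dvd⟩
  rw [hI]
  haveI := (Ideal.span_singleton_prime h.1).mpr h
  exact Ideal.comap_isPrime _ _

end LadderEdges

section CharTwo

variable (K : Type*) [CommRing K] [CharP K 2]

/-- In characteristic two `per_3 = det_3`. [folklore] -/
theorem perPoly_three_eq_detPoly_of_charTwo : perPoly (Fin 3) K = detPoly (Fin 3) K := by
  have h2 : (2 : R K 3) = 0 := by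
    have := CharP.cast_eq_zero (R K 3) 2
    simpa using this
  rw [perPoly_three, detPoly_three]
  linear_combination (X (0, 0) * X (1, 2) * X (2, 1) + X (0, 1) * X (1, 0) * X (2, 2) +
    X (0, 2) * X (1, 1) * X (2, 0)) * h2

/-- The permanental cofactor `per(x(0|0)) = x₁₁x₂₂ + x₁₂x₂₁` equals the determinantal one in
characteristic two. [folklore] -/
theorem perCofactor_eq_detCofactor_of_charTwo :
    (X (1, 1) * X (2, 2) + X (1, 2) * X (2, 1) : R K 3) = detCofactor₃ K := by
  have h2 : (2 : R K 3) = 0 := by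
    have := CharP.cast_eq_zero (R K 3) 2
    simpa using this
  rw [detCofactor₃]
  linear_combination (X (1, 2) * X (2, 1)) * h2

variable [Nontrivial K]

/-- **`2 ≠ 0` is load-bearing for the Nagata ladder (and for the crux's analogue over other
fields):** in characteristic two, at `n = 3`, the ideal `(per_3, per(x(0|0)))` is NOT prime, i.e. the
ideators' lemma A fails verbatim (cf. `Literature.Barriers.ValiantsHypothesis.PermanentCharTwo`).
[folklore] -/
theorem span_per_cofactor_not_isPrime_three_charTwo :
    ¬ (Ideal.span {perPoly (Fin 3) K, X (1, 1) * X (2, 2) + X (1, 2) * X (2, 1)}).IsPrime := by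
  rw [perPoly_three_eq_detPoly_of_charTwo, perCofactor_eq_detCofactor_of_charTwo]
  exact span_det_cofactor_not_isPrime_three K

end CharTwo


/-! ## 4. Tangent vectors at the origin: a cheap obstruction to principality

For `n ≥ 2` the permanent has no terms of degree `< 2`, so every tangent vector `v` at the origin
gives an algebra map `S_n → K[ε]`, `x̄_p ↦ v_p ε`.  An ideal `P ⊆ (x̄)` containing two distinct
variables is never principal: a generator `g` would have to carry both coordinate directions in
its differential. -/

section Tangent

variable (K : Type*) [Field K] {n : ℕ}

/-- `ε ^ n = 0` in the dual numbers for `n ≥ 2`. [folklore] -/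
theorem eps_pow_eq_zero (hn : 2 ≤ n) : (ε : K[ε]) ^ n = 0 :=
  pow_eq_zero_of_le hn (by rw [pow_two, DualNumber.eps_mul_eps])

/-- Evaluation of `K[x]` on the tangent vector `v` at the origin: `x_p ↦ v_p ε`. [folklore] -/
def evalEps (v : Fin n × Fin n → K) : R K n →ₐ[K] K[ε] :=
  aeval fun p => v p • (ε : K[ε])

@[simp] theorem evalEps_X (v : Fin n × Fin n → K) (p : Fin n × Fin n) :
    evalEps K v (X p) = v p • (ε : K[ε]) :=
  aeval_X _ _

/-- `per_n ↦ 0` under every tangent evaluation, `n ≥ 2` (every term has degree `n ≥ 2`). [folklore] -/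
theorem evalEps_perPoly (hn : 2 ≤ n) (v : Fin n × Fin n → K) :
    evalEps K v (perPoly (Fin n) K) = 0 := by
  unfold perPoly Matrix.permanent
  rw [map_sum]
  refine Finset.sum_eq_zero fun σ _ => ?_
  rw [map_prod]
  have h : ∀ i : Fin n, evalEps K v (Matrix.mvPolynomialX (Fin n) (Fin n) K (σ i) i) =
      algebraMap K K[ε] (v (σ i, i)) * ε := fun i => by
    simp [Matrix.mvPolynomialX, Algebra.smul_def]
  simp_rw [h, Finset.prod_mul_distrib, Finset.prod_const, Finset.card_univ, Fintype.card_fin,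
    eps_pow_eq_zero K hn, mul_zero]

/-- The tangent evaluation descends to `S_n = K[x]/(per_n)` (`n ≥ 2`). [folklore] -/
def tang (hn : 2 ≤ n) (v : Fin n × Fin n → K) : S K n →ₐ[K] K[ε] :=
  Ideal.Quotient.liftₐ (perIdeal K n) (evalEps K v) fun a ha => by
    obtain ⟨r, rfl⟩ := Ideal.mem_span_singleton'.mp ha
    rw [map_mul, evalEps_perPoly K hn, mul_zero]

@[simp] theorem tang_mk (hn : 2 ≤ n) (v : Fin n × Fin n → K) (f : R K n) :
    tang K hn v (Ideal.Quotient.mk (perIdeal K n) f) = evalEps K v f :=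
  rfl

/-- The value at the origin `S_n → K` (as the `ε`-free part of any tangent evaluation). [folklore] -/
def cst (hn : 2 ≤ n) : S K n →ₐ[K] K :=
  (TrivSqZeroExt.fstHom K K K).comp (tang K hn 0)

/-- The `ε`-free part of a tangent evaluation does not depend on the tangent vector. [folklore] -/
theorem fst_tang (hn : 2 ≤ n) (v : Fin n × Fin n → K) (x : S K n) :
    TrivSqZeroExt.fst (tang K hn v x) = cst K hn x := by
  have h : (TrivSqZeroExt.fstHom K K K).comp (tang K hn v) = cst K hn := by
    apply Ideal.Quotient.algHom_ext
    apply MvPolynomial.algHom_ext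
    intro p
    simp [cst]
  exact AlgHom.congr_fun h x

@[simp] theorem cst_xbar (hn : 2 ≤ n) (p : Fin n × Fin n) : cst K hn (xbar K p) = 0 := by
  simp [cst, xbar]

@[simp] theorem snd_tang_xbar (hn : 2 ≤ n) (v : Fin n × Fin n → K) (p : Fin n × Fin n) :
    TrivSqZeroExt.snd (tang K hn v (xbar K p)) = v p := by
  simp [xbar]

/-- Leibniz rule for the `ε`-part. [folklore] -/
theorem snd_tang_mul (hn : 2 ≤ n) (v : Fin n × Fin n → K) (x y : S K n) :
    TrivSqZeroExt.snd (tang K hn v (x * y)) =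
      cst K hn x * TrivSqZeroExt.snd (tang K hn v y) +
        TrivSqZeroExt.snd (tang K hn v x) * cst K hn y := by
  rw [map_mul, DualNumber.snd_mul, fst_tang, fst_tang]

/-- **Tangent obstruction.** For `n ≥ 2`, an ideal of `S_n` all of whose elements vanish at the
origin and which contains two distinct variables `x̄_p, x̄_q` is not principal. [folklore] -/
theorem not_isPrincipal_of_xbar_mem (hn : 2 ≤ n) {P : Ideal (S K n)}
    (hP : ∀ x ∈ P, cst K hn x = 0) {p q : Fin n × Fin n} (hpq : p ≠ q)
    (hp : xbar K p ∈ P) (hq : xbar K q ∈ P) : ¬ P.IsPrincipal := by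
  classical
  intro hprinc
  obtain ⟨g, hg⟩ := hprinc.1
  have hgP : g ∈ P := by rw [hg]; exact Submodule.mem_span_singleton_self g
  have hcg : cst K hn g = 0 := hP g hgP
  rw [hg] at hp hq
  obtain ⟨a, ha⟩ := Submodule.mem_span_singleton.mp hp
  obtain ⟨b, hb⟩ := Submodule.mem_span_singleton.mp hq
  -- differentiate `a g = x̄_p`, `b g = x̄_q` along a tangent vector `v`
  have key : ∀ v : Fin n × Fin n → K,
      v p = cst K hn a * TrivSqZeroExt.snd (tang K hn v g) ∧
        v q = cst K hn b * TrivSqZeroExt.snd (tang K hn v g) := by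
    intro v
    refine ⟨?_, ?_⟩
    · have h := congrArg (fun x => TrivSqZeroExt.snd (tang K hn v x)) ha
      simp only [smul_eq_mul, snd_tang_mul, hcg, mul_zero, add_zero, snd_tang_xbar] at h
      exact h.symm
    · have h := congrArg (fun x => TrivSqZeroExt.snd (tang K hn v x)) hb
      simp only [smul_eq_mul, snd_tang_mul, hcg, mul_zero, add_zero, snd_tang_xbar] at h
      exact h.symm
  obtain ⟨h1, h2⟩ := key fun r => if r = p then 1 else 0
  obtain ⟨-, h4⟩ := key fun r => if r = q then 1 else 0
  simp only [if_true, if_neg hpq.symm] at h1 h2 h4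
  have hD : TrivSqZeroExt.snd (tang K hn (fun r => if r = p then 1 else 0) g) ≠ 0 := by
    intro h0
    rw [h0, mul_zero] at h1
    exact one_ne_zero h1
  have hb0 : cst K hn b = 0 := by
    rcases mul_eq_zero.mp h2.symm with h | h
    · exact h
    · exact absurd h hD
  rw [hb0, zero_mul] at h4
  exact one_ne_zero h4

/-- The irrelevant ideal `(x̄) = ker (S_n → K)` is prime and, for `n ≥ 2`, not principal. [folklore] -/
theorem ker_cst_not_isPrincipal (hn : 2 ≤ n) : ¬ (RingHom.ker (cst K hn)).IsPrincipal := by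
  refine not_isPrincipal_of_xbar_mem K hn (P := RingHom.ker (cst K hn))
    (fun x hx => (RingHom.mem_ker).mp hx)
    (p := (⟨0, by omega⟩, ⟨0, by omega⟩)) (q := (⟨0, by omega⟩, ⟨1, by omega⟩)) ?_ ?_ ?_
  · simp [Prod.ext_iff, Fin.ext_iff]
  · exact (RingHom.mem_ker).mpr (cst_xbar K hn _)
  · exact (RingHom.mem_ker).mpr (cst_xbar K hn _)

/-- For every `n ≥ 2`, `S_n` has a prime (indeed maximal) ideal that is not principal. [folklore] -/
theorem exists_isPrime_not_isPrincipal (hn : 2 ≤ n) :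
    ∃ P : Ideal (S K n), P.IsPrime ∧ ¬ P.IsPrincipal :=
  ⟨RingHom.ker (cst K hn), RingHom.ker_isPrime _, ker_cst_not_isPrincipal K hn⟩

end Tangent

/-! ## 5. (a) Load-bearing analysis — the height-one hypothesis

Dropping `P.height = 1` from the crux is fatal at every `n ≥ 2` (so in particular at `n = 3`):
the irrelevant ideal is prime and not principal.  Any proof must use the height. -/

/-- The crux with the hypothesis `P.height = 1` dropped. [folklore] -/
def PermHypersurfaceFactorialWithoutHeightOne : Prop :=
  ∀ n : ℕ, 3 ≤ n → ∀ P : Ideal (S ℂ n), P.IsPrime → P.IsPrincipal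

/-- **Any proof must use `height P = 1`:** without it the statement fails at `n = 3` (the
irrelevant ideal of `S_3`). [folklore] -/
theorem permHypersurfaceFactorial_false_without_heightOne :
    ¬ PermHypersurfaceFactorialWithoutHeightOne := by
  intro h
  obtain ⟨P, hP, hnp⟩ := exists_isPrime_not_isPrincipal ℂ (n := 3) (by norm_num)
  exact hnp (h 3 le_rfl P hP)


/-! ## 6. (a) Load-bearing analysis — the guard `3 ≤ n`: the crux FAILS at `n = 2`

`S_2 = K[x]/(x₀₀x₁₁ + x₀₁x₁₀)` is the quadric cone (`≅ K[a,b,c,d]/(ad - bc)`, `Cl = ℤ`).  The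
ideal `P₂ = (x̄₀₀, x̄₀₁)` (the image of "row 0") is prime (it is the kernel of "kill row 0"
`S_2 → K[x]`), of height one (minimal over `(x̄₀₀)` by `x̄₀₁ x̄₁₀ = -x̄₀₀ x̄₁₁`, Krull), and not
principal (tangent obstruction §4). -/

section TwoByTwo

variable (K : Type*) [Field K]

/-- Substitute `0` for the two variables of row `r`. [folklore] -/
def killRow (r : Fin 2) : R K 2 →ₐ[K] R K 2 :=
  aeval fun p => if p.1 = r then 0 else X p

@[simp] theorem killRow_X (r : Fin 2) (p : Fin 2 × Fin 2) :
    killRow K r (X p) = if p.1 = r then 0 else X p :=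
  aeval_X _ _

/-- The ideal `(x_{r0}, x_{r1})` of `K[x]`. [folklore] -/
def rowIdeal (r : Fin 2) : Ideal (R K 2) := Ideal.span {X (r, 0), X (r, 1)}

theorem X_mem_rowIdeal (r j : Fin 2) : (X (r, j) : R K 2) ∈ rowIdeal K r := by
  fin_cases j
  · exact Ideal.subset_span (by simp)
  · exact Ideal.subset_span (by simp)

/-- `f - f|_{row r = 0} ∈ (x_{r0}, x_{r1})`. [folklore] -/
theorem sub_killRow_mem (r : Fin 2) (f : R K 2) : f - killRow K r f ∈ rowIdeal K r := by
  induction f using MvPolynomial.induction_on with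
  | C a => simp [killRow]
  | add p q hp hq =>
    rw [map_add, add_sub_add_comm]
    exact add_mem hp hq
  | mul_X p i hp =>
    rw [map_mul, killRow_X]
    split_ifs with hi
    · rw [mul_zero, sub_zero]
      obtain ⟨a, b⟩ := i
      simp only at hi
      subst hi
      exact Ideal.mul_mem_left _ _ (X_mem_rowIdeal K a b)
    · rw [← sub_mul]
      exact Ideal.mul_mem_right _ _ hp

theorem perPoly_mem_rowIdeal (r : Fin 2) : perPoly (Fin 2) K ∈ rowIdeal K r := by
  rw [perPoly_two]
  fin_cases r
  · exact add_mem (Ideal.mul_mem_right _ _ (X_mem_rowIdeal K 0 0))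
      (Ideal.mul_mem_right _ _ (X_mem_rowIdeal K 0 1))
  · exact add_mem (Ideal.mul_mem_left _ _ (X_mem_rowIdeal K 1 1))
      (Ideal.mul_mem_left _ _ (X_mem_rowIdeal K 1 0))

theorem perIdeal_le_rowIdeal (r : Fin 2) : perIdeal K 2 ≤ rowIdeal K r :=
  (Ideal.span_singleton_le_iff_mem _).mpr (perPoly_mem_rowIdeal K r)

/-- `ker (kill row r) = (x_{r0}, x_{r1})`; in particular `rowIdeal K r` is prime. [folklore] -/
theorem ker_killRow (r : Fin 2) : RingHom.ker (killRow K r) = rowIdeal K r := by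
  apply le_antisymm
  · intro f hf
    have h := sub_killRow_mem K r f
    rwa [(RingHom.mem_ker).mp hf, sub_zero] at h
  · rw [rowIdeal, Ideal.span_le]
    rintro g (rfl | rfl)
    · simp [RingHom.mem_ker]
    · simp [RingHom.mem_ker]

instance rowIdeal_isPrime (r : Fin 2) : (rowIdeal K r).IsPrime :=
  ker_killRow K r ▸ RingHom.ker_isPrime (killRow K r)

theorem killRow_perPoly (r : Fin 2) : killRow K r (perPoly (Fin 2) K) = 0 := by
  rw [perPoly_two]
  fin_cases r <;> simp

/-- "Kill row 0" descends to `ψ : S_2 → K[x]`. [folklore] -/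
def psi : S K 2 →ₐ[K] R K 2 :=
  Ideal.Quotient.liftₐ (perIdeal K 2) (killRow K 0) fun a ha => by
    obtain ⟨r, rfl⟩ := Ideal.mem_span_singleton'.mp ha
    rw [map_mul, killRow_perPoly, mul_zero]

@[simp] theorem psi_mk (f : R K 2) : psi K (Ideal.Quotient.mk (perIdeal K 2) f) = killRow K 0 f :=
  rfl

/-- The witness ideal `P₂ = (x̄₀₀, x̄₀₁) ⊂ S_2`. [folklore] -/
def P₂ : Ideal (S K 2) := Ideal.span {xbar K (0, 0), xbar K (0, 1)}

theorem P₂_eq_map : P₂ K = (rowIdeal K 0).map (Ideal.Quotient.mk (perIdeal K 2)) := by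
  rw [rowIdeal, Ideal.map_span, Set.image_pair]
  rfl

/-- `P₂ = ker ψ`. [folklore] -/
theorem ker_psi : RingHom.ker (psi K) = P₂ K := by
  ext x
  obtain ⟨f, rfl⟩ := Ideal.Quotient.mk_surjective x
  rw [RingHom.mem_ker, psi_mk, ← RingHom.mem_ker, ker_killRow, P₂_eq_map]
  constructor
  · exact Ideal.mem_map_of_mem _
  · intro h
    obtain ⟨g, hg, hgf⟩ :=
      (Ideal.mem_map_iff_of_surjective _ Ideal.Quotient.mk_surjective).mp h
    rw [Ideal.Quotient.eq] at hgf
    have h' : g - f ∈ rowIdeal K 0 := perIdeal_le_rowIdeal K 0 hgf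
    simpa using sub_mem hg h'

/-- `P₂` is prime. [folklore] -/
instance P₂_isPrime : (P₂ K).IsPrime := ker_psi K ▸ RingHom.ker_isPrime (psi K)

/-- `per_2` is a prime polynomial (vzG Thm 3.4 in tree, `perPoly_irreducible`). [folklore] -/
theorem perPoly_prime_two : Prime (perPoly (Fin 2) K) :=
  UniqueFactorizationMonoid.irreducible_iff_prime.mp perPoly_irreducible

instance perIdeal_two_isPrime : (perIdeal K 2).IsPrime :=
  (Ideal.span_singleton_prime (perPoly_prime_two K).ne_zero).mpr (perPoly_prime_two K)

theorem xbar_zero_zero_ne_zero : xbar K ((0, 0) : Fin 2 × Fin 2) ≠ 0 := by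
  intro h
  rw [xbar, Ideal.Quotient.eq_zero_iff_mem] at h
  refine not_mem_span_of_eval (fun p => if p = (0, 0) then 1 else 0) ?_ ?_ h
  · rintro g rfl
    simp [perPoly_two]
  · simp

theorem P₂_ne_bot : P₂ K ≠ ⊥ := fun h => by
  have hmem : xbar K (0, 0) ∈ P₂ K := Ideal.subset_span (Set.mem_insert _ _)
  rw [h, Ideal.mem_bot] at hmem
  exact xbar_zero_zero_ne_zero K hmem

theorem xbar_one_zero_not_mem_P₂ : xbar K ((1, 0) : Fin 2 × Fin 2) ∉ P₂ K := by
  intro h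
  rw [← ker_psi, RingHom.mem_ker, xbar, psi_mk, killRow_X] at h
  simp only [Fin.one_eq_zero_iff, OfNat.ofNat_ne_one, if_false] at h
  exact X_ne_zero _ h

/-- `x̄₀₁ x̄₁₀ = -x̄₀₀ x̄₁₁` in `S_2`. [folklore] -/
theorem xbar_rel_two :
    xbar K ((0, 1) : Fin 2 × Fin 2) * xbar K (1, 0) = -(xbar K (0, 0) * xbar K (1, 1)) := by
  simp only [xbar, ← map_mul, ← map_neg]
  rw [Ideal.Quotient.eq, Ideal.mem_span_singleton']
  exact ⟨1, by rw [perPoly_two]; ring⟩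

/-- `P₂` is a minimal prime of the principal ideal `(x̄₀₀)`. [folklore] -/
theorem P₂_mem_minimalPrimes :
    P₂ K ∈ (Ideal.span {xbar K ((0, 0) : Fin 2 × Fin 2)}).minimalPrimes := by
  refine ⟨⟨inferInstance, ?_⟩, ?_⟩
  · rw [Ideal.span_singleton_le_iff_mem]
    exact Ideal.subset_span (Set.mem_insert _ _)
  · rintro q ⟨hq, hIq⟩ hqP
    rw [Ideal.span_singleton_le_iff_mem] at hIq
    have h01 : xbar K (0, 1) ∈ q := by
      have hmem : xbar K ((0, 1) : Fin 2 × Fin 2) * xbar K (1, 0) ∈ q := by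
        rw [xbar_rel_two]
        exact q.neg_mem_iff.mpr (q.mul_mem_right _ hIq)
      rcases hq.mem_or_mem hmem with h | h
      · exact h
      · exact absurd (hqP h) (xbar_one_zero_not_mem_P₂ K)
    rw [P₂, Ideal.span_le]
    rintro x (rfl | rfl)
    · exact hIq
    · exact h01

/-- `height P₂ = 1`. [folklore] -/
theorem height_P₂ : (P₂ K).height = 1 := by
  apply le_antisymm
  · exact Ideal.height_le_one_of_isPrincipal_of_mem_minimalPrimes _ _ (P₂_mem_minimalPrimes K)
  · rw [Order.one_le_iff_ne_zero]
    exact fun h => P₂_ne_bot K (Ideal.height_eq_zero_iff_eq_bot.mp h)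

/-- `P₂` is not principal. [folklore] -/
theorem P₂_not_isPrincipal : ¬ (P₂ K).IsPrincipal := by
  refine not_isPrincipal_of_xbar_mem K (n := 2) le_rfl (P := P₂ K) ?_
    (p := (0, 0)) (q := (0, 1)) (by decide) (Ideal.subset_span (Set.mem_insert _ _))
    (Ideal.subset_span (Set.mem_insert_of_mem _ rfl))
  have hle : P₂ K ≤ RingHom.ker (cst K (n := 2) le_rfl) := by
    rw [P₂, Ideal.span_le]
    rintro x (rfl | rfl)
    · simp [RingHom.mem_ker]
    · simp [RingHom.mem_ker]
  exact fun x hx => (RingHom.mem_ker).mp (hle hx)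

/-! ### H(2) is false: the ideator's height-three lever needs `3 ≤ n` too

The row-`0` partials of `per_2` are `∂per_2/∂x₀₀ = x₁₁`, `∂per_2/∂x₀₁ = x₁₀`; they lie in the
prime `rowIdeal K 1 = (x₁₀, x₁₁)` of height ≤ 2 (Krull's height theorem), so the statement
`RowPartialsHeightThree` of card `subpermanent-height-three-nagata` fails at `n = 2` — as it must,
since factorial ⟺ H(n). -/

theorem pderiv_perPoly_two (j : Fin 2) :
    pderiv ((0 : Fin 2), j) (perPoly (Fin 2) K) ∈ rowIdeal K 1 := by
  rw [perPoly_two]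
  fin_cases j
  · simp only [Derivation.leibniz, pderiv_X, map_add, smul_eq_mul]
    simp
    exact X_mem_rowIdeal K 1 1
  · simp only [Derivation.leibniz, pderiv_X, map_add, smul_eq_mul]
    simp
    exact X_mem_rowIdeal K 1 0

theorem rowIdeal_ne_top (r : Fin 2) : rowIdeal K r ≠ ⊤ := Ideal.IsPrime.ne_top inferInstance

/-- `height (x₁₀, x₁₁) ≤ 2` (Krull's height theorem; two generators). [folklore] -/
theorem height_rowIdeal_le (r : Fin 2) : (rowIdeal K r).height ≤ 2 := by
  refine (Ideal.height_le_spanFinrank _ (rowIdeal_ne_top K r)).trans ?_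
  have h : (rowIdeal K r).spanFinrank ≤ ({X (r, 0), X (r, 1)} : Set (R K 2)).ncard :=
    Submodule.spanFinrank_span_le_ncard_of_finite (Set.toFinite _)
  refine (Nat.cast_le.mpr h).trans ?_
  exact_mod_cast (Set.ncard_insert_le _ _).trans (by simp)

/-- **H(2) fails:** there is a prime of `K[x]` (`2 × 2`) containing the row-`0` partials of
`per_2` of height `< 3` (namely `(x₁₀, x₁₁)`, height 2). [folklore] -/
theorem rowPartialsHeightThree_false_at_two :
    ¬ (∀ P : Ideal (R K 2), P.IsPrime →
        (∀ j : Fin 2, pderiv ((0 : Fin 2), j) (perPoly (Fin 2) K) ∈ P) → 3 ≤ P.height) := by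
  intro h
  have h3 := h (rowIdeal K 1) inferInstance (pderiv_perPoly_two K)
  have h2 := height_rowIdeal_le K 1
  have : (3 : ℕ∞) ≤ 2 := h3.trans h2
  exact absurd this (by decide)

end TwoByTwo

/-- **The crux's conclusion FAILS at `n = 2`** (witness `P₂`). [folklore] -/
theorem factorialAt_two_false : ¬ FactorialAt 2 := fun h =>
  P₂_not_isPrincipal ℂ (h (P₂ ℂ) inferInstance (height_P₂ ℂ))

/-- The crux with its guard weakened from `3 ≤ n` to `2 ≤ n`. [folklore] -/
def PermHypersurfaceFactorialWithoutThreeLe : Prop :=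
  ∀ n : ℕ, 2 ≤ n → ∀ P : Ideal (S ℂ n), P.IsPrime → P.height = 1 → P.IsPrincipal

/-- **Any proof must use `3 ≤ n`** (more precisely: must fail at `n = 2`): with the guard weakened
to `2 ≤ n` the statement is false. [folklore] -/
theorem permHypersurfaceFactorial_false_without_three_le :
    ¬ PermHypersurfaceFactorialWithoutThreeLe := fun h =>
  factorialAt_two_false (h 2 le_rfl)


/-! ## 7. The other small cases are vacuous: `FactorialAt 0` and `FactorialAt 1` hold

So below the guard the picture is complete: for `n ≤ 2`, `FactorialAt n ↔ n ≠ 2`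
(`factorialAt_iff_ne_two_of_le_two`).  The guard `3 ≤ n` is the minimal correct one. -/

section SmallN

/-- `per_0 = 1` (empty permanent). [folklore] -/
theorem perPoly_zero (K : Type*) [CommRing K] : perPoly (Fin 0) K = 1 := by
  simp [perPoly, Matrix.permanent_isEmpty]

/-- `per_1 = x₀₀`. [folklore] -/
theorem perPoly_one (K : Type*) [CommRing K] : perPoly (Fin 1) K = X (0, 0) := by
  simp [perPoly, Matrix.mvPolynomialX]

/-- `S_0 = ℂ[∅]/(1) = 0` has no primes: `FactorialAt 0` holds vacuously. [folklore] -/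
theorem factorialAt_zero : FactorialAt 0 := by
  intro P hP _
  exfalso
  have hsub : Subsingleton (S ℂ 0) :=
    Ideal.Quotient.subsingleton_iff.mpr (by rw [perIdeal, perPoly_zero, Ideal.span_singleton_one])
  exact hP.ne_top (eq_top_iff.mpr fun x _ => by rw [Subsingleton.elim x 0]; exact P.zero_mem)

/-- `(x₀₀) = ker (ℂ[x₀₀] → ℂ, x₀₀ ↦ 0)`, so it is maximal and `S_1 ≅ ℂ` is a field. [folklore] -/
theorem perIdeal_one_isMaximal (K : Type*) [Field K] : (perIdeal K 1).IsMaximal := by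
  have hker : RingHom.ker (aeval (0 : Fin 1 × Fin 1 → K) : R K 1 →ₐ[K] K) = perIdeal K 1 := by
    apply le_antisymm
    · intro f hf
      rw [RingHom.mem_ker] at hf
      have h0 : constantCoeff f = 0 := by
        have := hf
        rwa [show (aeval (0 : Fin 1 × Fin 1 → K) : R K 1 →ₐ[K] K) f = constantCoeff f by
          rw [aeval_zero]; simp] at this
      -- every monomial of `f` involves the unique variable
      have hX : perIdeal K 1 = Ideal.span (X '' (Set.univ : Set (Fin 1 × Fin 1))) := by
        rw [perIdeal, perPoly_one]
        congr 1
        ext g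
        simp only [Set.mem_singleton_iff, Set.image_univ, Set.mem_range]
        constructor
        · rintro rfl
          exact ⟨(0, 0), rfl⟩
        · rintro ⟨p, rfl⟩
          rw [Subsingleton.elim p (0, 0)]
      rw [hX, mem_ideal_span_X_image]
      intro m hm
      have hm0 : m ≠ 0 := by
        rintro rfl
        rw [mem_support_iff] at hm
        exact hm h0
      obtain ⟨i, hi⟩ : ∃ i, m i ≠ 0 := not_forall.mp fun hall => hm0 (Finsupp.ext hall)
      exact ⟨i, Set.mem_univ _, hi⟩
    · rw [perIdeal, perPoly_one, Ideal.span_singleton_le_iff_mem, RingHom.mem_ker]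
      simp
  rw [← hker]
  exact RingHom.ker_isMaximal_of_surjective _ fun k => ⟨C k, by simp⟩

/-- `S_1 ≅ ℂ` has only the prime `⊥`, of height `0`: `FactorialAt 1` holds vacuously. [folklore] -/
theorem factorialAt_one : FactorialAt 1 := by
  intro P hP hht
  exfalso
  have hmax := perIdeal_one_isMaximal ℂ
  have hF : IsField (S ℂ 1) := (Ideal.Quotient.maximal_ideal_iff_isField_quotient _).mp hmax
  haveI : Nontrivial (S ℂ 1) := Ideal.Quotient.nontrivial_iff.mpr hmax.ne_top
  have hbot : P = ⊥ := by
    refine (Submodule.eq_bot_iff _).mpr fun x hx => ?_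
    by_contra hx0
    obtain ⟨y, hy⟩ := hF.mul_inv_cancel hx0
    exact hP.ne_top (P.eq_top_of_isUnit_mem hx (IsUnit.of_mul_eq_one y hy))
  rw [hbot, Ideal.height_bot] at hht
  exact zero_ne_one hht

/-- Below the guard: `FactorialAt n ↔ n ≠ 2` for `n ≤ 2`. [folklore] -/
theorem factorialAt_iff_ne_two_of_le_two {n : ℕ} (hn : n ≤ 2) : FactorialAt n ↔ n ≠ 2 := by
  interval_cases n
  · exact ⟨fun _ => by decide, fun _ => factorialAt_zero⟩
  · exact ⟨fun _ => by decide, fun _ => factorialAt_one⟩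
  · exact ⟨fun h _ => factorialAt_two_false h, fun h => absurd rfl h⟩

end SmallN


/-! ## 8. (b) Tightness of the codimension input at `n = 3`

The SGA2 line consumes von zur Gathen's Lemma 2.3 (`vonzurGathen1987_singPerm_height_holds`:
every prime over `singPermIdeal K n = (per_n, ∂per_n)` has height ≥ 5, `n ≥ 3`) with ZERO slack:
Grothendieck–Samuel needs `S_n` factorial/regular in codimension ≤ 3, i.e. `codim Sing ≥ 4` in
`Spec S_n`, i.e. height ≥ 5 in `K[x]`.  How much room is there really?  At `n = 3` at most one:
the prime `Q₃ = (x_1•, x_2•)` ("rows 1 and 2 vanish") lies over the singular ideal and has height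
≤ 6 (true value 6: Laubenbacher–Swanson, the components of `V(2 × 2 subpermanents)` are one row /
one column / an anti-rank-one `2 × 2` block).  In general `(x_1•, x_2•)` gives height ≤ `2n`, the
upper end of the known window `[5, 2n]`; jobs j006245/j006248 probe `n = 4, 5`. -/

section KillVars

variable {K : Type*} [CommRing K] {σ : Type*} (T : Set σ) [DecidablePred (· ∈ T)]

/-- Substitute `0` for the variables in `T`. [folklore] -/
def killVars : MvPolynomial σ K →ₐ[K] MvPolynomial σ K :=
  aeval fun p => if p ∈ T then 0 else X p

@[simp] theorem killVars_X (p : σ) :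
    killVars (K := K) T (X p) = if p ∈ T then 0 else X p :=
  aeval_X _ _

/-- `f - f|_{T = 0} ∈ (x_p : p ∈ T)`. [folklore] -/
theorem sub_killVars_mem (f : MvPolynomial σ K) :
    f - killVars (K := K) T f ∈ Ideal.span (X '' T) := by
  induction f using MvPolynomial.induction_on with
  | C a => simp [killVars]
  | add p q hp hq =>
    rw [map_add, add_sub_add_comm]
    exact add_mem hp hq
  | mul_X p i hp =>
    rw [map_mul, killVars_X]
    split_ifs with hi
    · rw [mul_zero, sub_zero]
      exact Ideal.mul_mem_left _ _ (Ideal.subset_span ⟨i, hi, rfl⟩)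
    · rw [← sub_mul]
      exact Ideal.mul_mem_right _ _ hp

/-- `ker (kill T) = (x_p : p ∈ T)`. [folklore] -/
theorem ker_killVars : RingHom.ker (killVars (K := K) T) = Ideal.span (X '' T) := by
  apply le_antisymm
  · intro f hf
    have h := sub_killVars_mem (K := K) T f
    rwa [(RingHom.mem_ker).mp hf, sub_zero] at h
  · rw [Ideal.span_le]
    rintro _ ⟨p, hp, rfl⟩
    simp [RingHom.mem_ker, hp]

/-- The ideal generated by any set of variables is prime (over a domain). [folklore] -/
theorem isPrime_span_X_image [IsDomain K] : (Ideal.span (X '' T) : Ideal (MvPolynomial σ K)).IsPrime :=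
  ker_killVars (K := K) T ▸ RingHom.ker_isPrime _

end KillVars

section TightThree

open Literature.Computability.AlgebraicComplexity.VonZurGathen

/-- The coordinates of rows `1` and `2` of a `3 × 3` matrix. [folklore] -/
def rows12 : Set (Fin 3 × Fin 3) := {p | p.1 ≠ 0}

instance : DecidablePred (· ∈ rows12) := fun p => inferInstanceAs (Decidable (p.1 ≠ 0))

/-- `Q₃ = (x_1•, x_2•) ⊂ K[x]`, `3 × 3`. [folklore] -/
def Q₃ (K : Type*) [CommRing K] : Ideal (R K 3) := Ideal.span (X '' rows12)

/-- `per_3` and all its partials die when rows `1, 2` are killed: `singPermIdeal K 3 ≤ Q₃`.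
[folklore] -/
theorem singPermIdeal_le_Q₃ (K : Type*) [CommRing K] : singPermIdeal K 3 ≤ Q₃ K := by
  rw [Q₃, ← ker_killVars, singPermIdeal, Ideal.span_le]
  rintro g (rfl | ⟨⟨i, j⟩, rfl⟩)
  · simp [RingHom.mem_ker, perPoly_three, rows12]
  · rw [SetLike.mem_coe, RingHom.mem_ker, perPoly_three]
    fin_cases i <;> fin_cases j <;>
      simp [rows12, Derivation.leibniz, pderiv_X]

/-- `height Q₃ ≤ 6` (six generators, Krull). [folklore] -/
theorem height_Q₃_le (K : Type*) [Field K] : (Q₃ K).height ≤ 6 := by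
  haveI : (Q₃ K).IsPrime := isPrime_span_X_image _
  refine (Ideal.height_le_spanFinrank _ (Ideal.IsPrime.ne_top inferInstance)).trans ?_
  have hfin : (X '' rows12 : Set (R K 3)).Finite := (Set.toFinite rows12).image _
  have h1 : (Q₃ K).spanFinrank ≤ (X '' rows12 : Set (R K 3)).ncard :=
    Submodule.spanFinrank_span_le_ncard_of_finite hfin
  have h2 : (X '' rows12 : Set (R K 3)).ncard ≤ rows12.ncard := Set.ncard_image_le (Set.toFinite _)
  have h3 : rows12.ncard = 6 := by
    rw [show rows12 = ((Finset.univ.filter fun p : Fin 3 × Fin 3 => p.1 ≠ 0 : Finset _) : Set _) by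
      ext p; simp [rows12], Set.ncard_coe_finset]
    decide
  exact_mod_cast h1.trans (h2.trans h3.le)

/-- **The vzG window at `n = 3`:** there is a prime over the singular ideal of `per_3` of height in
`[5, 6]` — the lower bound is von zur Gathen's Lemma 2.3 (tree theorem), the upper bound the
witness `Q₃`.  So the codimension input of the SGA2 line can be improved by at most one at
`n = 3` (and `R₅` is false for `S_3`). [folklore] -/
theorem singPerm_height_window_three :
    ∃ Q : Ideal (R ℂ 3), Q.IsPrime ∧ singPermIdeal ℂ 3 ≤ Q ∧ (5 : ℕ∞) ≤ Q.height ∧ Q.height ≤ 6 := by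
  haveI : (Q₃ ℂ).IsPrime := isPrime_span_X_image _
  refine ⟨Q₃ ℂ, inferInstance, singPermIdeal_le_Q₃ ℂ, ?_, height_Q₃_le ℂ⟩
  exact vonzurGathen1987_singPerm_height_holds ℂ (by norm_num) 3 le_rfl (Q₃ ℂ) inferInstance
    (singPermIdeal_le_Q₃ ℂ)

end TightThree


/-! ### The window `[5, 2n]` for every `n ≥ 3`, and vzG's own guard

For every `n`, the prime `(x_0•, x_1•)` ("rows 0 and 1 vanish") contains `per_n` and all its
partials (every (sub)permanent keeps at least one of the two rows) and has height ≤ `2n`.  So the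
height of primes over the singular ideal is only known to lie in `[5, 2n]`; and at `n = 2` the same
witness has height ≤ 4 < 5: von zur Gathen's guard `3 ≤ m` is itself necessary. -/

section TightGeneral

open Literature.Computability.AlgebraicComplexity.VonZurGathen

variable (K : Type*) [CommRing K] (n : ℕ)

/-- The coordinates of rows `0` and `1`. [folklore] -/
def rows01 : Set (Fin n × Fin n) := {p | (p.1 : ℕ) < 2}

@[simp] theorem mem_rows01 (p : Fin n × Fin n) : p ∈ rows01 n ↔ (p.1 : ℕ) < 2 := Iff.rfl

instance : DecidablePred (· ∈ rows01 n) := fun p => inferInstanceAs (Decidable ((p.1 : ℕ) < 2))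

/-- `Q = (x_0•, x_1•) ⊂ K[x]`. [folklore] -/
def Qrows : Ideal (R K n) := Ideal.span (X '' rows01 n)

/-- Killing rows `0, 1` kills `per_n` (`n ≥ 1`). [folklore] -/
theorem killVars_perPoly (hn : 1 ≤ n) : killVars (K := K) (rows01 n) (perPoly (Fin n) K) = 0 := by
  unfold perPoly Matrix.permanent
  rw [map_sum]
  refine Finset.sum_eq_zero fun σ _ => ?_
  rw [map_prod]
  exact Finset.prod_eq_zero (Finset.mem_univ (σ.symm ⟨0, hn⟩)) (by simp [Matrix.mvPolynomialX])

/-- Killing rows `0, 1` kills every partial `∂per_n/∂x_rc` (`n ≥ 2`): the subpermanent deleting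
row `r` keeps row `1` (if `r = 0`) or row `0`. [folklore] -/
theorem killVars_pderiv_perPoly (hn : 2 ≤ n) (r c : Fin n) :
    killVars (K := K) (rows01 n) (pderiv (r, c) (perPoly (Fin n) K)) = 0 := by
  have h := subperm_map ((killVars (K := K) (rows01 n) : R K n →ₐ[K] R K n) : R K n →+* R K n)
    (Matrix.mvPolynomialX (Fin n) (Fin n) K) (· ≠ c) (· ≠ r)
  rw [RingHom.coe_coe] at h
  rw [pderiv_perPoly, ← h]
  by_cases hr : (r : ℕ) = 0
  · refine Matrix.subperm_eq_zero_of_row _ (⟨1, hn⟩ : Fin n) ?_ ?_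
    · intro he
      have := congrArg Fin.val he
      simp only at this
      omega
    · intro i _
      simp [Matrix.mvPolynomialX]
  · refine Matrix.subperm_eq_zero_of_row _ (⟨0, by omega⟩ : Fin n) ?_ ?_
    · intro he
      have := congrArg Fin.val he
      simp only at this
      omega
    · intro i _
      simp [Matrix.mvPolynomialX]

/-- `singPermIdeal K n ≤ (x_0•, x_1•)` for `n ≥ 2`. [folklore] -/
theorem singPermIdeal_le_Qrows (hn : 2 ≤ n) : singPermIdeal K n ≤ Qrows K n := by
  rw [Qrows, ← ker_killVars, singPermIdeal, Ideal.span_le]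
  rintro g (rfl | ⟨⟨r, c⟩, rfl⟩)
  · exact (RingHom.mem_ker).mpr (killVars_perPoly K n (by omega))
  · exact (RingHom.mem_ker).mpr (killVars_pderiv_perPoly K n hn r c)

variable {K n} in
/-- `height (x_0•, x_1•) ≤ 2n` (Krull's height theorem, `2n` generators). [folklore] -/
theorem height_Qrows_le {K : Type*} [Field K] {n : ℕ} (hn : 2 ≤ n) :
    (Qrows K n).height ≤ 2 * n := by
  haveI : (Qrows K n).IsPrime := isPrime_span_X_image (K := K) (rows01 n)
  refine (Ideal.height_le_spanFinrank _ (Ideal.IsPrime.ne_top ‹_›)).trans ?_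
  have h1 : (Qrows K n).spanFinrank ≤ (X '' rows01 n : Set (R K n)).ncard :=
    Submodule.spanFinrank_span_le_ncard_of_finite ((Set.toFinite _).image _)
  have h2 : (X '' rows01 n : Set (R K n)).ncard ≤ (rows01 n).ncard :=
    Set.ncard_image_le (Set.toFinite _)
  have h3 : (rows01 n).ncard ≤ 2 * n := by
    have hsub : rows01 n ⊆
        (fun a : Fin 2 × Fin n => ((⟨(a.1 : ℕ), by omega⟩ : Fin n), a.2)) '' Set.univ := by
      rintro ⟨i, j⟩ hij
      rw [mem_rows01] at hij
      exact ⟨(⟨(i : ℕ), hij⟩, j), Set.mem_univ _, by ext <;> simp⟩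
    calc (rows01 n).ncard ≤ _ := Set.ncard_le_ncard hsub (Set.toFinite _)
      _ ≤ (Set.univ : Set (Fin 2 × Fin n)).ncard := Set.ncard_image_le (Set.toFinite _)
      _ = 2 * n := by
        rw [Set.ncard_univ, Nat.card_eq_fintype_card, Fintype.card_prod, Fintype.card_fin,
          Fintype.card_fin]
  exact_mod_cast h1.trans (h2.trans h3)

/-- **The window `[5, 2n]`:** for every `n ≥ 3` some prime over the singular ideal of `per_n`
has height between `5` (von zur Gathen, tree theorem) and `2n` (the witness `(x_0•, x_1•)`).
Conjecturally the true codimension of `Sing V(per_n)` is `2n`; only `≥ 5` (`≥ 6` for `n ≥ 6`,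
BCMV 2025) is in print. [folklore] -/
theorem singPerm_height_window (n : ℕ) (hn : 3 ≤ n) :
    ∃ Q : Ideal (R ℂ n), Q.IsPrime ∧ singPermIdeal ℂ n ≤ Q ∧
      (5 : ℕ∞) ≤ Q.height ∧ Q.height ≤ 2 * n := by
  haveI : (Qrows ℂ n).IsPrime := isPrime_span_X_image (K := ℂ) (rows01 n)
  refine ⟨Qrows ℂ n, inferInstance, singPermIdeal_le_Qrows ℂ n (by omega), ?_,
    height_Qrows_le (by omega)⟩
  exact vonzurGathen1987_singPerm_height_holds ℂ (by norm_num) n hn (Qrows ℂ n) inferInstance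
    (singPermIdeal_le_Qrows ℂ n (by omega))

/-- von zur Gathen's Lemma 2.3 with its guard weakened to `2 ≤ m`. [folklore] -/
def SingPermHeightFiveWithoutThreeLe : Prop :=
  ∀ m : ℕ, 2 ≤ m → ∀ P : Ideal (MvPolynomial (Fin m × Fin m) ℂ), P.IsPrime →
    singPermIdeal ℂ m ≤ P → (5 : ℕ∞) ≤ P.height

/-- **vzG's guard `3 ≤ m` is necessary:** at `m = 2` the irrelevant ideal `(x_0•, x_1•)` lies over
the singular ideal and has height ≤ 4. [folklore] -/
theorem singPermHeightFive_false_without_three_le : ¬ SingPermHeightFiveWithoutThreeLe := by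
  intro h
  haveI : (Qrows ℂ 2).IsPrime := isPrime_span_X_image (K := ℂ) (rows01 2)
  have h5 := h 2 le_rfl (Qrows ℂ 2) inferInstance (singPermIdeal_le_Qrows ℂ 2 le_rfl)
  have h4 : (Qrows ℂ 2).height ≤ 2 * 2 := height_Qrows_le le_rfl
  have : (5 : ℕ∞) ≤ 4 := h5.trans h4
  exact absurd this (by decide)

end TightGeneral


/-! # GENERATION 3 (refuter-cdisprove-stmt-ValiantsHypothesis-5666-g3-0, 2026-08-16)

§9  abstract / localised tangent obstruction; the vertex local ring `(S_2)_𝔪` is neither a UFD nor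
    regular (`not_ufm_loc_two`, `not_isRegularLocalRing_loc_two`), `dim`-bookkeeping `height_le_three_two`;
§10 (a) the hypothesis `P.IsPrime` is load-bearing (`permHypersurfaceFactorial_false_without_isPrime`);
§11 Targets: the picked line `derivation-symbolic-square` — guard profile at `n = 2`
    (`pickedLine_guard_profile_at_two`: only `stub_missingPartial` fails; stubs 3, 4 vacuous);
§12 boundaries of the general stubs of line `nagata-corner-subpermanent`
    (`regularThree_false_without_homogeneous`, `linearFormPrime_false_without_regular`);
§13 the threshold window of `stub_missingPartial` in the lead's currency: the prime
    `(x̄_0•, x̄_1•) ⊂ S_n` contains all partials and has height `≤ 2n-1`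
    (`missingPartialAtHeight_false`: threshold `2n-1` is FALSE for every `n ≥ 2`; at `n = 3`: 3 true / 5 false);
§14 the FIELD is load-bearing: `not_ufm_S_three_charTwo` — in characteristic two `S_3` is not a UFD
    (witness `I₂(rows 1,2)/(per₃)`, height ≤ 1 by a chain of kernels, non-principal by a second-order
    tangent obstruction with two-jets `S_3 → K[η][ε]`), `permHypersurfaceFactorialOver_false_of_charTwo`. -/

/-! ## Abstract tangent obstruction (two derivations suffice) -/

section AbstractTangent

variable {B : Type*} [CommRing B] {K : Type*} [Field K]

/-- **Abstract tangent obstruction (principal-ideal form).** Let `c : B → K` be a ring map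
("value at a point") and `δ₁, δ₂ : B → K` two `c`-derivations (Leibniz
`δ(xy) = c x · δ y + δ x · c y`).  A principal ideal `(g)` on which `c` vanishes cannot contain
`b₁, b₂` with `δ₁ b₁ = 1`, `δ₂ b₁ = 0`, `δ₂ b₂ = 1`: from `b₁ = a₁ g`, `b₂ = a₂ g` one gets
`1 = c(a₁) δ₁(g)`, `0 = c(a₁) δ₂(g)`, `1 = c(a₂) δ₂(g)` — impossible. [folklore] -/
theorem false_of_leibniz_span_singleton (c : B →+* K) (δ₁ δ₂ : B → K)
    (h₁ : ∀ x y, δ₁ (x * y) = c x * δ₁ y + δ₁ x * c y)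
    (h₂ : ∀ x y, δ₂ (x * y) = c x * δ₂ y + δ₂ x * c y)
    {g : B} (hP : ∀ x ∈ Ideal.span {g}, c x = 0) {b₁ b₂ : B} (hb₁ : b₁ ∈ Ideal.span {g})
    (hb₂ : b₂ ∈ Ideal.span {g}) (h11 : δ₁ b₁ = 1) (h21 : δ₂ b₁ = 0) (h22 : δ₂ b₂ = 1) :
    False := by
  have hcg : c g = 0 := hP g (Ideal.mem_span_singleton_self g)
  obtain ⟨a₁, rfl⟩ := Ideal.mem_span_singleton'.mp hb₁
  obtain ⟨a₂, rfl⟩ := Ideal.mem_span_singleton'.mp hb₂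
  rw [h₁, hcg, mul_zero, add_zero] at h11
  rw [h₂, hcg, mul_zero, add_zero] at h21 h22
  have hca₁ : c a₁ ≠ 0 := fun h => by rw [h, zero_mul] at h11; exact zero_ne_one h11
  have hδ₂g : δ₂ g = 0 := by
    rcases mul_eq_zero.mp h21 with h | h
    · exact absurd h hca₁
    · exact h
  rw [hδ₂g, mul_zero] at h22
  exact zero_ne_one h22

/-- **Abstract tangent obstruction.** With `c, δ₁, δ₂` as above, an ideal `P` on which `c`
vanishes and which contains `b₁, b₂` with `δ₁ b₁ = 1`, `δ₂ b₁ = 0`, `δ₂ b₂ = 1` is not principal.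
(`not_isPrincipal_of_xbar_mem` of §4 is the instance `B = S_n`, `c = cst`, `δ = snd ∘ tang`.)
[folklore] -/
theorem not_isPrincipal_of_leibniz (c : B →+* K) (δ₁ δ₂ : B → K)
    (h₁ : ∀ x y, δ₁ (x * y) = c x * δ₁ y + δ₁ x * c y)
    (h₂ : ∀ x y, δ₂ (x * y) = c x * δ₂ y + δ₂ x * c y)
    {P : Ideal B} (hP : ∀ x ∈ P, c x = 0) {b₁ b₂ : B} (hb₁ : b₁ ∈ P) (hb₂ : b₂ ∈ P)
    (h11 : δ₁ b₁ = 1) (h21 : δ₂ b₁ = 0) (h22 : δ₂ b₂ = 1) : ¬ P.IsPrincipal := by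
  intro hprinc
  obtain ⟨g, hg⟩ := hprinc.1
  have hg' : P = Ideal.span {g} := hg
  rw [hg'] at hP hb₁ hb₂
  exact false_of_leibniz_span_singleton c δ₁ δ₂ h₁ h₂ hP hb₁ hb₂ h11 h21 h22

end AbstractTangent

/-! ## The local ring of `S_n` at the vertex: tangent functionals extend to the localisation -/

section VertexLocal

variable (K : Type*) [Field K] {n : ℕ}

/-- The irrelevant ideal `𝔪 = (x̄_ij) = ker (S_n → K)` (vertex of the cone). [folklore] -/
abbrev irr (hn : 2 ≤ n) : Ideal (S K n) := RingHom.ker (cst K hn)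

instance irr_isPrime (hn : 2 ≤ n) : (irr K hn).IsPrime := RingHom.ker_isPrime _

/-- `𝔪` is maximal (`S_n → K` is onto). [folklore] -/
theorem irr_isMaximal (hn : 2 ≤ n) : (irr K hn).IsMaximal :=
  RingHom.ker_isMaximal_of_surjective _ fun k => ⟨algebraMap K (S K n) k, by simp⟩

/-- The local ring `(S_n)_𝔪` of the permanental hypersurface at the vertex. [folklore] -/
abbrev Loc (hn : 2 ≤ n) : Type _ := Localization.AtPrime (irr K hn)

theorem isUnit_tang_of_not_mem (hn : 2 ≤ n) (v : Fin n × Fin n → K) {s : S K n}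
    (hs : s ∉ irr K hn) : IsUnit (tang K hn v s) := by
  rw [TrivSqZeroExt.isUnit_iff_isUnit_fst, fst_tang]
  exact isUnit_iff_ne_zero.mpr (by simpa [RingHom.mem_ker] using hs)

/-- The tangent evaluation `S_n → K[ε]` along `v` extends to the local ring at the vertex
(elements off `𝔪` have non-zero value, hence become units of `K[ε]`). [folklore] -/
def tangL (hn : 2 ≤ n) (v : Fin n × Fin n → K) : Loc K hn →+* K[ε] :=
  IsLocalization.lift (M := (irr K hn).primeCompl) (g := (tang K hn v : S K n →+* K[ε]))
    fun s => isUnit_tang_of_not_mem K hn v s.2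

@[simp] theorem tangL_algebraMap (hn : 2 ≤ n) (v : Fin n × Fin n → K) (x : S K n) :
    tangL K hn v (algebraMap (S K n) (Loc K hn) x) = tang K hn v x :=
  IsLocalization.lift_eq _ _

/-- Value at the vertex, on the local ring. [folklore] -/
def cstL (hn : 2 ≤ n) : Loc K hn →+* K :=
  (TrivSqZeroExt.fstHom K K K).toRingHom.comp (tangL K hn 0)

@[simp] theorem cstL_algebraMap (hn : 2 ≤ n) (x : S K n) :
    cstL K hn (algebraMap (S K n) (Loc K hn) x) = cst K hn x := by
  simp only [cstL, RingHom.coe_comp, Function.comp_apply, tangL_algebraMap]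
  exact fst_tang K hn 0 x

/-- The `ε`-free part of `tangL v` does not depend on `v`. [folklore] -/
theorem fst_tangL (hn : 2 ≤ n) (v : Fin n × Fin n → K) (y : Loc K hn) :
    TrivSqZeroExt.fst (tangL K hn v y) = cstL K hn y := by
  have h : (TrivSqZeroExt.fstHom K K K).toRingHom.comp (tangL K hn v) = cstL K hn := by
    apply IsLocalization.ringHom_ext (irr K hn).primeCompl
    refine RingHom.ext fun x => ?_
    simp only [RingHom.coe_comp, Function.comp_apply, tangL_algebraMap, cstL_algebraMap]
    exact fst_tang K hn v x
  exact RingHom.congr_fun h y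

/-- Leibniz rule on the local ring. [folklore] -/
theorem snd_tangL_mul (hn : 2 ≤ n) (v : Fin n × Fin n → K) (x y : Loc K hn) :
    TrivSqZeroExt.snd (tangL K hn v (x * y)) =
      cstL K hn x * TrivSqZeroExt.snd (tangL K hn v y) +
        TrivSqZeroExt.snd (tangL K hn v x) * cstL K hn y := by
  rw [map_mul, DualNumber.snd_mul, fst_tangL, fst_tangL]

@[simp] theorem snd_tangL_xbar (hn : 2 ≤ n) (v : Fin n × Fin n → K) (p : Fin n × Fin n) :
    TrivSqZeroExt.snd (tangL K hn v (algebraMap (S K n) (Loc K hn) (xbar K p))) = v p := by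
  simp

/-- `cstL` kills the maximal ideal of the local ring (`= 𝔪 · (S_n)_𝔪`). [folklore] -/
theorem cstL_eq_zero_of_mem_maximalIdeal (hn : 2 ≤ n) {y : Loc K hn}
    (hy : y ∈ IsLocalRing.maximalIdeal (Loc K hn)) : cstL K hn y = 0 := by
  rw [← IsLocalization.AtPrime.map_eq_maximalIdeal (irr K hn) (Loc K hn)] at hy
  have hle : (irr K hn).map (algebraMap (S K n) (Loc K hn)) ≤ RingHom.ker (cstL K hn) := by
    rw [Ideal.map_le_iff_le_comap]
    intro x hx
    simpa [RingHom.mem_ker] using hx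
  exact (RingHom.mem_ker).mp (hle hy)

/-- Non-units of the local ring have value `0` at the vertex. [folklore] -/
theorem cstL_eq_zero_of_not_isUnit (hn : 2 ≤ n) {y : Loc K hn} (hy : ¬ IsUnit y) :
    cstL K hn y = 0 :=
  cstL_eq_zero_of_mem_maximalIdeal K hn ((IsLocalRing.mem_maximalIdeal _).mpr hy)

/-- **Localised tangent obstruction.** A principal ideal `(p)` of `(S_n)_𝔪`, `p` a non-unit,
cannot contain (the images of) two distinct variables `x̄_a, x̄_b`: differentiate `x̄_a = a₁ p`,
`x̄_b = a₂ p` along the coordinate tangent vectors `e_a`, `e_b` (the argument of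
`false_of_leibniz_span_singleton`, inlined in this concrete ring to keep instance unification cheap).
[folklore] -/
theorem not_xbar_mem_span_pair (hn : 2 ≤ n) {p : Loc K hn} (hp : ¬ IsUnit p)
    {a b : Fin n × Fin n} (hab : a ≠ b)
    (ha : algebraMap (S K n) (Loc K hn) (xbar K a) ∈ Ideal.span {p})
    (hb : algebraMap (S K n) (Loc K hn) (xbar K b) ∈ Ideal.span {p}) : False := by
  classical
  have hcp : cstL K hn p = 0 := cstL_eq_zero_of_not_isUnit K hn hp
  obtain ⟨a₁, ha₁⟩ := Ideal.mem_span_singleton'.mp ha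
  obtain ⟨a₂, ha₂⟩ := Ideal.mem_span_singleton'.mp hb
  set va : Fin n × Fin n → K := fun r => if r = a then 1 else 0 with hva
  set vb : Fin n × Fin n → K := fun r => if r = b then 1 else 0 with hvb
  -- δ_v(a_i p) = cstL(a_i) · δ_v(p)   (since cstL p = 0)
  have e11 := congrArg (fun y => TrivSqZeroExt.snd (tangL K hn va y)) ha₁
  have e21 := congrArg (fun y => TrivSqZeroExt.snd (tangL K hn vb y)) ha₁
  have e22 := congrArg (fun y => TrivSqZeroExt.snd (tangL K hn vb y)) ha₂
  simp only [snd_tangL_mul, hcp, mul_zero, add_zero, snd_tangL_xbar] at e11 e21 e22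
  -- e11 : cstL a₁ * δ_a p = va a = 1 ;  e21 : cstL a₁ * δ_b p = vb a = 0 ; e22 : cstL a₂ * δ_b p = 1
  have hvaa : va a = 1 := by rw [hva]; exact if_pos rfl
  have hvba : vb a = 0 := by rw [hvb]; exact if_neg hab
  have hvbb : vb b = 1 := by rw [hvb]; exact if_pos rfl
  simp only [hvaa, hvba, hvbb] at e11 e21 e22
  have hca₁ : cstL K hn a₁ ≠ 0 := fun h => by rw [h, zero_mul] at e11; exact zero_ne_one e11
  have hδ : TrivSqZeroExt.snd (tangL K hn vb p) = 0 := by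
    rcases mul_eq_zero.mp e21 with h | h
    · exact absurd h hca₁
    · exact h
  rw [hδ, mul_zero] at e22
  exact zero_ne_one e22

/-- **The vertex of the quadric cone `S_2` is not factorial:** `(S_2)_𝔪` is not a UFD.
A prime factor `p` of `x̄₀₀` would divide `x̄₀₁ x̄₁₀ = -x̄₀₀ x̄₁₁`, hence `x̄₀₁` or `x̄₁₀`, and then
`(p)` contains two variables — excluded by the localised tangent obstruction. [folklore] -/
theorem not_ufm_loc_two : ¬ UniqueFactorizationMonoid (Loc K (n := 2) le_rfl) := by
  intro hufm
  haveI : IsDomain (S K 2) := isDomain_S K (n := 2) (by norm_num)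
  let ι : S K 2 →+* Loc K (n := 2) le_rfl := algebraMap (S K 2) (Loc K (n := 2) le_rfl)
  have hinj : Function.Injective ι :=
    IsLocalization.injective (Loc K (n := 2) le_rfl) (irr K (n := 2) le_rfl).primeCompl_le_nonZeroDivisors
  have h00 : ι (xbar K (0, 0)) ≠ 0 := fun h =>
    xbar_zero_zero_ne_zero K (hinj (by rw [h, map_zero]))
  have hnu : ¬ IsUnit (ι (xbar K (0, 0))) := by
    intro h
    have h' := h.map (cstL K (n := 2) le_rfl)
    rw [cstL_algebraMap, cst_xbar, isUnit_iff_ne_zero] at h'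
    exact h' rfl
  obtain ⟨p, hpirr, hpdvd⟩ := WfDvdMonoid.exists_irreducible_factor hnu h00
  have hp : Prime p := UniqueFactorizationMonoid.irreducible_iff_prime.mp hpirr
  have hpu : ¬ IsUnit p := hp.not_unit
  have hmem00 : ι (xbar K (0, 0)) ∈ Ideal.span {p} := Ideal.mem_span_singleton.mpr hpdvd
  haveI hI : (Ideal.span {p}).IsPrime := (Ideal.span_singleton_prime hp.ne_zero).mpr hp
  -- prime avoidance upstairs, in `S_2` (the comap of `(p)` is a prime containing `x̄₀₀`)
  set Q : Ideal (S K 2) := (Ideal.span {p}).comap ι with hQdef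
  have hQ : Q.IsPrime := Ideal.comap_isPrime ι _
  have h00Q : xbar K (0, 0) ∈ Q := Ideal.mem_comap.mpr hmem00
  have hmemQ : xbar K ((0, 1) : Fin 2 × Fin 2) * xbar K (1, 0) ∈ Q := by
    rw [xbar_rel_two]
    exact Q.neg_mem_iff.mpr (Q.mul_mem_right _ h00Q)
  rcases hQ.mem_or_mem hmemQ with h | h
  · exact not_xbar_mem_span_pair K le_rfl hpu (a := (0, 0)) (b := (0, 1)) (by decide) hmem00
      (Ideal.mem_comap.mp h)
  · exact not_xbar_mem_span_pair K le_rfl hpu (a := (0, 0)) (b := (1, 0)) (by decide) hmem00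
      (Ideal.mem_comap.mp h)

/-- **The vertex of `S_2` is not a regular point:** `(S_2)_𝔪` is not a regular local ring
(regular local rings are UFDs — Auslander–Buchsbaum, tree theorem
`uniqueFactorizationMonoid_of_isRegularLocalRing`). [folklore] -/
theorem not_isRegularLocalRing_loc_two : ¬ IsRegularLocalRing (Loc K (n := 2) le_rfl) := by
  intro h
  haveI : IsDomain (S K 2) := isDomain_S K (n := 2) (by norm_num)
  exact not_ufm_loc_two K
    (Literature.AlgebraicGeometry.Resolution.uniqueFactorizationMonoid_of_isRegularLocalRing _ h)

/-- Every prime of `S_2` has height `≤ 3` (`dim S_2 ≤ dim K[x_{2×2}] - 1 = 3`). [folklore] -/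
theorem height_le_three_two (P : Ideal (S K 2)) [P.IsPrime] : P.height ≤ 3 := by
  haveI : IsDomain (S K 2) := isDomain_S K (n := 2) (by norm_num)
  have h0 : (0 : WithBot ℕ∞) ≤ ringKrullDim (S K 2) := ringKrullDim_nonneg_of_nontrivial
  have hne : ringKrullDim (S K 2) ≠ ⊥ := by
    intro h
    rw [h] at h0
    exact WithBot.not_coe_le_bot 0 h0
  obtain ⟨d, hd⟩ := WithBot.ne_bot_iff_exists.mp hne
  have h1 : (P.height : WithBot ℕ∞) ≤ ringKrullDim (S K 2) := Ideal.height_le_ringKrullDim_of_isPrime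
  have h2 : ringKrullDim (S K 2) + 1 ≤ ringKrullDim (R K 2) :=
    ringKrullDim_quotient_succ_le_of_nonZeroDivisor
      (mem_nonZeroDivisors_of_ne_zero (perPoly_prime_two K).ne_zero)
  have h3 : ringKrullDim (R K 2) = ((4 : ℕ∞) : WithBot ℕ∞) := by
    rw [MvPolynomial.ringKrullDim_of_isNoetherianRing, ringKrullDim_eq_zero_of_field]
    simp
  rw [← hd] at h1 h2
  rw [h3] at h2
  have h1' : P.height ≤ d := WithBot.coe_le_coe.mp h1
  have h2' : d + 1 ≤ 4 := by
    rw [← WithBot.coe_one, ← WithBot.coe_add] at h2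
    exact WithBot.coe_le_coe.mp h2
  have hd_top : d ≠ ⊤ := by
    rintro rfl
    rw [top_add] at h2'
    exact absurd h2' (by decide)
  obtain ⟨k, rfl⟩ := ENat.ne_top_iff_exists.mp hd_top
  have hk : k + 1 ≤ 4 := by exact_mod_cast h2'
  have hk3 : k ≤ 3 := by omega
  exact h1'.trans (by exact_mod_cast hk3)

end VertexLocal


/-! ## (a) Load-bearing analysis — the hypothesis `P.IsPrime`

Dropping primality is fatal (even polynomial rings have non-principal height-one IDEALS, e.g.
`(x², xy) ⊂ ℂ[x,y]`): in `S_3` the ideal `I = x̄₀₀ · 𝔪` has height one and is not principal. -/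

section WithoutIsPrime

variable (K : Type*) [Field K] {n : ℕ}

/-- The witness ideal `x̄₀₀ · 𝔪 ⊂ S_n`. [folklore] -/
def xIrr (hn : 2 ≤ n) : Ideal (S K n) :=
  Ideal.span {xbar K ((⟨0, by omega⟩, ⟨0, by omega⟩) : Fin n × Fin n)} * irr K hn

theorem xbar_mem_irr (hn : 2 ≤ n) (p : Fin n × Fin n) : xbar K p ∈ irr K hn :=
  (RingHom.mem_ker).mpr (cst_xbar K hn p)

theorem xbar_ne_zero (hn : 2 ≤ n) (p : Fin n × Fin n) : xbar K p ≠ 0 := by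
  intro h
  rw [xbar, Ideal.Quotient.eq_zero_iff_mem] at h
  refine not_mem_span_of_eval (fun q => if q = p then 1 else 0) ?_ ?_ h
  · rintro g rfl
    -- every summand of `per_n` has `n ≥ 2` variable factors, at most one of which survives at `e_p`
    unfold perPoly Matrix.permanent
    rw [map_sum]
    refine Finset.sum_eq_zero fun σ _ => ?_
    rw [map_prod]
    -- two distinct indices `i ≠ j` exist since `n ≥ 2`; at most one factor is nonzero
    by_contra hne
    have hall : ∀ i : Fin n, (σ i, i) = p := by
      intro i
      by_contra hi
      apply hne
      apply Finset.prod_eq_zero (Finset.mem_univ i)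
      simp [Matrix.mvPolynomialX, hi]
    have h01 : (⟨0, by omega⟩ : Fin n) = ⟨1, by omega⟩ := by
      have e0 := congrArg Prod.snd (hall ⟨0, by omega⟩)
      have e1 := congrArg Prod.snd (hall ⟨1, by omega⟩)
      exact e0.trans e1.symm
    exact absurd (congrArg Fin.val h01) (by simp)
  · simp

/-- `x̄₀₀ · 𝔪` is not principal (`n ≥ 2`): a generator `g = x̄₀₀ u` would give `x̄_p = u c_p` for every
variable; if `u(0) = 0` the principal ideal `(u)` contains two variables (tangent obstruction), and
if `u(0) ≠ 0` then `g ∈ x̄₀₀ 𝔪` forces `u ∈ 𝔪`, contradiction. [folklore] -/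
theorem xIrr_not_isPrincipal (hn : 2 ≤ n) : ¬ (xIrr K hn).IsPrincipal := by
  classical
  haveI : IsDomain (S K n) := isDomain_S K (by omega)
  set o : Fin n := ⟨0, by omega⟩ with ho
  set l : Fin n := ⟨1, by omega⟩ with hl
  have hol : (o, o) ≠ (o, l) := by simp [ho, hl, Prod.ext_iff, Fin.ext_iff]
  intro hprinc
  obtain ⟨g, hg⟩ := hprinc.1
  have hg' : xIrr K hn = Ideal.span {g} := hg
  -- g ∈ x̄₀₀ 𝔪 : g = x̄₀₀ m, m ∈ 𝔪
  have hgI : g ∈ xIrr K hn := by rw [hg']; exact Ideal.mem_span_singleton_self g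
  obtain ⟨m, hm, hgm⟩ := Ideal.mem_span_singleton_mul.mp hgI
  -- x̄₀₀ x̄_p ∈ (g)
  have hmem : ∀ p, xbar K (o, o) * xbar K p ∈ Ideal.span {g} := fun p => by
    rw [← hg']
    exact Ideal.mul_mem_mul (Ideal.mem_span_singleton_self _) (xbar_mem_irr K hn p)
  -- hence x̄_p = m c_p
  have hdiv : ∀ p, ∃ c, xbar K p = m * c := by
    intro p
    obtain ⟨c, hc⟩ := Ideal.mem_span_singleton'.mp (hmem p)
    refine ⟨c, mul_left_cancel₀ (xbar_ne_zero K hn (o, o)) ?_⟩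
    rw [← hc, ← hgm]
    ring
  -- `m ∈ 𝔪`, so `(m)` is inside `𝔪` and contains `x̄₀₀`, `x̄₀₁`
  have hcm : cst K hn m = 0 := (RingHom.mem_ker).mp hm
  refine not_isPrincipal_of_xbar_mem K hn (P := Ideal.span {m}) ?_ hol ?_ ?_ inferInstance
  · intro x hx
    obtain ⟨y, rfl⟩ := Ideal.mem_span_singleton'.mp hx
    rw [map_mul, hcm, mul_zero]
  · obtain ⟨c, hc⟩ := hdiv (o, o)
    exact Ideal.mem_span_singleton'.mpr ⟨c, by rw [hc, mul_comm]⟩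
  · obtain ⟨c, hc⟩ := hdiv (o, l)
    exact Ideal.mem_span_singleton'.mpr ⟨c, by rw [hc, mul_comm]⟩

/-- `height (x̄₀₀ · 𝔪) = 1` (`n ≥ 2`): it lies inside the principal ideal `(x̄₀₀)` (Krull) and every
prime containing it contains `x̄₀₀² ≠ 0`. [folklore] -/
theorem height_xIrr (hn : 2 ≤ n) : (xIrr K hn).height = 1 := by
  classical
  haveI : IsDomain (S K n) := isDomain_S K (by omega)
  set o : Fin n := ⟨0, by omega⟩ with ho
  apply le_antisymm
  · -- ≤ 1 : monotonicity + Krull's height theorem for the principal ideal (x̄₀₀)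
    have hle : xIrr K hn ≤ Ideal.span {xbar K (o, o)} := Ideal.mul_le_right
    refine (Ideal.height_mono hle).trans ?_
    have hne : Ideal.span {xbar K (o, o)} ≠ ⊤ := by
      intro htop
      have h1 : (1 : S K n) ∈ Ideal.span {xbar K (o, o)} := htop ▸ Submodule.mem_top
      have h2 : cst K hn 1 = 0 := by
        obtain ⟨y, hy⟩ := Ideal.mem_span_singleton'.mp h1
        rw [← hy, map_mul, cst_xbar, mul_zero]
      rw [map_one] at h2
      exact one_ne_zero h2
    refine (Ideal.height_le_spanFinrank _ hne).trans ?_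
    have h : (Ideal.span {xbar K (o, o)}).spanFinrank ≤ ({xbar K (o, o)} : Set (S K n)).ncard :=
      Submodule.spanFinrank_span_le_ncard_of_finite (Set.toFinite _)
    rw [Set.ncard_singleton] at h
    exact_mod_cast h
  · -- ≥ 1 : every minimal prime is nonzero
    rw [Ideal.height_eq_inf_minimalPrimes]
    refine le_iInf₂ fun Q hQ => ?_
    haveI : Q.IsPrime := hQ.1.1
    rw [Order.one_le_iff_ne_zero (α := ℕ∞)]
    intro h0
    have hQbot : Q = ⊥ := Ideal.height_eq_zero_iff_eq_bot.mp h0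
    have hmem : xbar K (o, o) * xbar K (o, o) ∈ Q :=
      hQ.1.2 (Ideal.mul_mem_mul (Ideal.mem_span_singleton_self _) (xbar_mem_irr K hn _))
    rw [hQbot, Ideal.mem_bot, mul_self_eq_zero] at hmem
    exact xbar_ne_zero K hn _ hmem

/-- The crux with the hypothesis `P.IsPrime` dropped. [folklore] -/
def PermHypersurfaceFactorialWithoutIsPrime : Prop :=
  ∀ n : ℕ, 3 ≤ n → ∀ P : Ideal (S ℂ n), P.height = 1 → P.IsPrincipal

/-- **Any proof must use `P.IsPrime`:** the height-one ideal `x̄₀₀ · 𝔪 ⊂ S_3` is not principal.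
(Harmless but real: "height-one ideal" ≠ "height-one prime" even in a UFD.) [folklore] -/
theorem permHypersurfaceFactorial_false_without_isPrime : ¬ PermHypersurfaceFactorialWithoutIsPrime :=
  fun h => xIrr_not_isPrincipal ℂ (n := 3) (by norm_num) (h 3 le_rfl _ (height_xIrr ℂ (by norm_num)))

end WithoutIsPrime

/-! ## Targets — the picked line `derivation-symbolic-square` (lead skeleton, 2026-08-16)

The lead's four stubs, read back literally (bodies below the guard `3 ≤ n`).  All four are TRUE
statements for `n ≥ 3` (vzG's proved height bound; the derivation test for the symbolic square —
the regular direction of the Jacobian criterion, valid over every field; Grothendieck–Samuel for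
hypersurfaces, proved in tree; Fossum's graded descent, proved in tree), so there is no stub to
kill.  What the disprover CAN certify is where the guard bites: at `n = 2` exactly ONE of the four
fails — `stub_missingPartial` — while `stub_localFactorial` and `stub_gradedDescent` hold at `n = 2`
VACUOUSLY (their hypotheses are false at the vertex, and so are their conclusions).  So in this line
the guard `3 ≤ n` is consumed only through von zur Gathen's bound, and stubs 3–4 carry no hidden
dependence on `n` (consistent with, and sharper than, the planner's joint check `DisproofCheck.lean`). -/

section TargetsDerivationSymbolicSquare

/-- Body of the lead's `stub_missingPartial` at one `n`. [folklore] -/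
def MissingPartialAt (n : ℕ) : Prop :=
  ∀ (P : Ideal (MvPolynomial (Fin n × Fin n) ℂ ⧸ Ideal.span {perPoly (Fin n) ℂ})) [P.IsPrime],
    P.height ≤ 3 →
      ∃ ij : Fin n × Fin n, pderiv ij (perPoly (Fin n) ℂ) ∉
        P.comap (Ideal.Quotient.mk (Ideal.span {perPoly (Fin n) ℂ}))

/-- Body of the lead's `stub_localFactorial` at one `n`. [folklore] -/
def LocalFactorialAt (n : ℕ) : Prop :=
  (∀ (Q : Ideal (MvPolynomial (Fin n × Fin n) ℂ ⧸ Ideal.span {perPoly (Fin n) ℂ})) [Q.IsPrime],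
      Q.height ≤ 3 → IsRegularLocalRing (Localization.AtPrime Q)) →
    ∀ (M : Ideal (MvPolynomial (Fin n × Fin n) ℂ ⧸ Ideal.span {perPoly (Fin n) ℂ})) [M.IsPrime],
      ∃ _ : IsDomain (Localization.AtPrime M), UniqueFactorizationMonoid (Localization.AtPrime M)

/-- Body of the lead's `stub_gradedDescent` at one `n`. [folklore] -/
def GradedDescentAt (n : ℕ) : Prop :=
  (∀ (M : Ideal (MvPolynomial (Fin n × Fin n) ℂ ⧸ Ideal.span {perPoly (Fin n) ℂ})) [M.IsMaximal],
      ∃ _ : IsDomain (Localization.AtPrime M), UniqueFactorizationMonoid (Localization.AtPrime M)) →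
    ∃ _ : IsDomain (MvPolynomial (Fin n × Fin n) ℂ ⧸ Ideal.span {perPoly (Fin n) ℂ}),
      UniqueFactorizationMonoid (MvPolynomial (Fin n × Fin n) ℂ ⧸ Ideal.span {perPoly (Fin n) ℂ})

/-- Read-back: the lead's `stub_missingPartial` is `∀ n ≥ 3, MissingPartialAt n`, its
`stub_localFactorial` is `∀ n ≥ 3, LocalFactorialAt n`, its `stub_gradedDescent` is
`∀ n ≥ 3, GradedDescentAt n` (definitional). [folklore] -/
theorem stubs_readback :
    ((∀ n : ℕ, 3 ≤ n → MissingPartialAt n) ↔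
      ∀ n : ℕ, 3 ≤ n →
        ∀ (P : Ideal (MvPolynomial (Fin n × Fin n) ℂ ⧸ Ideal.span {perPoly (Fin n) ℂ})) [P.IsPrime],
          P.height ≤ 3 →
            ∃ ij : Fin n × Fin n, pderiv ij (perPoly (Fin n) ℂ) ∉
              P.comap (Ideal.Quotient.mk (Ideal.span {perPoly (Fin n) ℂ}))) ∧
    ((∀ n : ℕ, 3 ≤ n → LocalFactorialAt n) ↔
      ∀ n : ℕ, 3 ≤ n →
        (∀ (Q : Ideal (MvPolynomial (Fin n × Fin n) ℂ ⧸ Ideal.span {perPoly (Fin n) ℂ})) [Q.IsPrime],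
            Q.height ≤ 3 → IsRegularLocalRing (Localization.AtPrime Q)) →
          ∀ (M : Ideal (MvPolynomial (Fin n × Fin n) ℂ ⧸ Ideal.span {perPoly (Fin n) ℂ})) [M.IsPrime],
            ∃ _ : IsDomain (Localization.AtPrime M),
              UniqueFactorizationMonoid (Localization.AtPrime M)) ∧
    ((∀ n : ℕ, 3 ≤ n → GradedDescentAt n) ↔
      ∀ n : ℕ, 3 ≤ n →
        (∀ (M : Ideal (MvPolynomial (Fin n × Fin n) ℂ ⧸ Ideal.span {perPoly (Fin n) ℂ})) [M.IsMaximal],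
            ∃ _ : IsDomain (Localization.AtPrime M),
              UniqueFactorizationMonoid (Localization.AtPrime M)) →
          ∃ _ : IsDomain (MvPolynomial (Fin n × Fin n) ℂ ⧸ Ideal.span {perPoly (Fin n) ℂ}),
            UniqueFactorizationMonoid (MvPolynomial (Fin n × Fin n) ℂ ⧸ Ideal.span {perPoly (Fin n) ℂ})) :=
  ⟨Iff.rfl, Iff.rfl, Iff.rfl⟩

/-- The partials of `per_2` are the complementary variables. [folklore] -/
theorem pderiv_perPoly_two_eq (K : Type*) [CommRing K] (i j : Fin 2) :
    ∃ q : Fin 2 × Fin 2, pderiv (i, j) (perPoly (Fin 2) K) = X q := by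
  rw [perPoly_two]
  fin_cases i <;> fin_cases j
  · exact ⟨(1, 1), by simp [Derivation.leibniz, pderiv_X]⟩
  · exact ⟨(1, 0), by simp [Derivation.leibniz, pderiv_X]⟩
  · exact ⟨(0, 1), by simp [Derivation.leibniz, pderiv_X]⟩
  · exact ⟨(0, 0), by simp [Derivation.leibniz, pderiv_X]⟩

/-- **Target 1 — the guard bites here: `stub_missingPartial` is FALSE at `n = 2`.** The vertex
`𝔪 = (x̄_ij)` of the quadric cone `S_2` is a prime of height `≤ 3 = dim S_2` whose preimage contains
every partial `∂per_2/∂x_ij = x_{1-i,1-j}`. [folklore] -/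
theorem missingPartialAt_two_false : ¬ MissingPartialAt 2 := by
  intro h
  obtain ⟨⟨i, j⟩, hij⟩ := h (irr ℂ (n := 2) le_rfl) (height_le_three_two ℂ _)
  apply hij
  obtain ⟨q, hq⟩ := pderiv_perPoly_two_eq ℂ i j
  rw [hq, Ideal.mem_comap]
  exact xbar_mem_irr ℂ le_rfl q

/-- **Target 3 — `stub_localFactorial` holds at `n = 2`, vacuously:** its hypothesis
"`S_2` is regular in codimension `≤ 3`" fails at the vertex (`not_isRegularLocalRing_loc_two`). [folklore] -/
theorem localFactorialAt_two : LocalFactorialAt 2 := by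
  intro hreg M _
  exact absurd (hreg (irr ℂ (n := 2) le_rfl) (height_le_three_two ℂ _))
    (not_isRegularLocalRing_loc_two ℂ)

/-- … and its conclusion is FALSE at `n = 2` (the vertex local ring is not factorial). [folklore] -/
theorem localFactorialAt_two_conclusion_false :
    ¬ ∀ (M : Ideal (MvPolynomial (Fin 2 × Fin 2) ℂ ⧸ Ideal.span {perPoly (Fin 2) ℂ})) [M.IsPrime],
      ∃ _ : IsDomain (Localization.AtPrime M), UniqueFactorizationMonoid (Localization.AtPrime M) := by
  intro h
  obtain ⟨_, hufm⟩ := h (irr ℂ (n := 2) le_rfl)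
  exact not_ufm_loc_two ℂ hufm

/-- **Target 4 — `stub_gradedDescent` holds at `n = 2`, vacuously:** its hypothesis fails at the
maximal ideal `𝔪` (`not_ufm_loc_two`). [folklore] -/
theorem gradedDescentAt_two : GradedDescentAt 2 := by
  intro h
  haveI := irr_isMaximal ℂ (n := 2) le_rfl
  obtain ⟨_, hufm⟩ := h (irr ℂ (n := 2) le_rfl)
  exact absurd hufm (not_ufm_loc_two ℂ)

/-- … and its conclusion is FALSE at `n = 2` (`S_2` is not a UFD: `factorialAt_two_false`). [folklore] -/
theorem gradedDescentAt_two_conclusion_false :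
    ¬ ∃ _ : IsDomain (MvPolynomial (Fin 2 × Fin 2) ℂ ⧸ Ideal.span {perPoly (Fin 2) ℂ}),
      UniqueFactorizationMonoid (MvPolynomial (Fin 2 × Fin 2) ℂ ⧸ Ideal.span {perPoly (Fin 2) ℂ}) := by
  rintro ⟨_, hufm⟩
  exact factorialAt_two_false ((factorialAt_iff_ufm (n := 2) (by norm_num)).mpr hufm)

/-- **Guard profile of the picked line at `n = 2`:** exactly the vzG stub fails. [folklore] -/
theorem pickedLine_guard_profile_at_two :
    ¬ MissingPartialAt 2 ∧ LocalFactorialAt 2 ∧ GradedDescentAt 2 :=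
  ⟨missingPartialAt_two_false, localFactorialAt_two, gradedDescentAt_two⟩

end TargetsDerivationSymbolicSquare

/-! ## 12. Boundaries of the general stubs of line `nagata-corner-subpermanent`

Stub C (`HomogeneousRegularThree`) and stub D (`LinearFormPrime`) of that line are general
commutative algebra.  Both are TRUE as filed; here are the nearest FALSE variants, so that no
prover relaxes them: (C) without homogeneity the fixed ORDER `f₁, f₂, f₃` need not be regular even
when every prime over `(f₁,f₂,f₃)` has height 3 — `(x(z+1), y(z+1), z)` in `ℚ[x,y,z]` (the planner's
`(xz, yz, z-1)` after `z ↦ z+1`; note `(z, x(z+1), y(z+1))` IS regular: only permutability is lost);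
(D) without "`a_{j₂}` regular modulo `a_{j₁}`" a linear form with a nonzero coefficient need not be
prime — `t·y₀ + t·y₁ = t (y₀ + y₁)` over `D = ℚ[t]`. -/

section GeneralStubBoundaries

/-- A polynomial is outside `span s` as soon as some ring map kills `s` but not it. [folklore] -/
theorem not_mem_span_of_map {A B : Type*} [CommRing A] [CommRing B] (φ : A →+* B) {s : Set A} {f : A}
    (hs : ∀ g ∈ s, φ g = 0) (hf : φ f ≠ 0) : f ∉ Ideal.span s := by
  intro h
  have hle : Ideal.span s ≤ RingHom.ker φ :=
    Ideal.span_le.mpr fun g hg => (RingHom.mem_ker).mpr (hs g hg)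
  exact hf ((RingHom.mem_ker).mp (hle h))

/-- Stub C of `nagata-corner-subpermanent` with the homogeneity hypotheses DROPPED. [folklore] -/
def RegularThreeWithoutHomogeneous : Prop :=
  ∀ (K : Type) [Field K] (σ : Type) [Fintype σ] (f₁ f₂ f₃ : MvPolynomial σ K),
    (∀ Q : Ideal (MvPolynomial σ K), Q.IsPrime → f₁ ∈ Q → f₂ ∈ Q → f₃ ∈ Q → (3 : ℕ∞) ≤ Q.height) →
    f₁ ≠ 0 ∧
      (∀ g : MvPolynomial σ K, f₂ * g ∈ Ideal.span {f₁} → g ∈ Ideal.span {f₁}) ∧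
      (∀ g : MvPolynomial σ K, f₃ * g ∈ Ideal.span {f₁, f₂} → g ∈ Ideal.span {f₁, f₂})

/-- **Homogeneity (i.e. permutability) is load-bearing in stub C.** In `ℚ[x,y,z]` take
`f₁ = x(z+1)`, `f₂ = y(z+1)`, `f₃ = z`: every prime containing them contains `z`, hence `x, y`
(as `z + 1 ∉ Q`), hence `(x,y,z)`, of height `3`; but `f₂ · x = y · f₁ ∈ (f₁)` while `x ∉ (f₁)`
(the point `(1, 0, -1)`). [folklore] -/
theorem regularThree_false_without_homogeneous : ¬ RegularThreeWithoutHomogeneous := by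
  intro h
  have h3 := h ℚ (Fin 3) (X 0 * (X 2 + 1)) (X 1 * (X 2 + 1)) (X 2) ?_
  · obtain ⟨-, h2, -⟩ := h3
    have hmem : X 1 * (X 2 + 1) * X 0 ∈ Ideal.span {(X 0 * (X 2 + 1) : MvPolynomial (Fin 3) ℚ)} :=
      Ideal.mem_span_singleton'.mpr ⟨X 1, by ring⟩
    refine not_mem_span_of_map (eval (![1, 0, -1] : Fin 3 → ℚ)) ?_ ?_ (h2 (X 0) hmem)
    · rintro g rfl
      simp
    · simp
  · -- every prime over (x(z+1), y(z+1), z) contains (x, y, z) = ker (f ↦ f(0)), of height ≥ 3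
    intro Q hQ h1 h2 hz
    have hz1 : (X 2 + 1 : MvPolynomial (Fin 3) ℚ) ∉ Q := by
      intro hz1
      have h1mem : (1 : MvPolynomial (Fin 3) ℚ) ∈ Q := by
        have := Q.sub_mem hz1 hz
        rwa [add_sub_cancel_left] at this
      exact hQ.ne_top ((Ideal.eq_top_iff_one _).mpr h1mem)
    have hx : (X 0 : MvPolynomial (Fin 3) ℚ) ∈ Q := (hQ.mem_or_mem h1).resolve_right hz1
    have hy : (X 1 : MvPolynomial (Fin 3) ℚ) ∈ Q := (hQ.mem_or_mem h2).resolve_right hz1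
    have hle : RingHom.ker (aeval (R := ℚ) (0 : Fin 3 → ℚ)) ≤ Q := by
      -- ker (f ↦ f(0)) = (x, y, z)
      intro f hf
      rw [RingHom.mem_ker] at hf
      have hX : Ideal.span (Set.range (X : Fin 3 → MvPolynomial (Fin 3) ℚ)) ≤ Q := by
        rw [Ideal.span_le]
        rintro _ ⟨i, rfl⟩
        fin_cases i
        · exact hx
        · exact hy
        · exact hz
      apply hX
      rw [show Set.range (X : Fin 3 → MvPolynomial (Fin 3) ℚ) = X '' Set.univ from Set.image_univ.symm,
        mem_ideal_span_X_image]
      intro m hm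
      have hm0 : m ≠ 0 := by
        rintro rfl
        rw [mem_support_iff] at hm
        apply hm
        have : constantCoeff f = 0 := by
          have h0 : aeval (0 : Fin 3 → ℚ) f = constantCoeff f := by
            rw [aeval_zero]; rfl
          rw [← h0]; exact hf
        exact this
      obtain ⟨i, hi⟩ : ∃ i, m i ≠ 0 := not_forall.mp fun hall => hm0 (Finsupp.ext hall)
      exact ⟨i, Set.mem_univ _, hi⟩
    have hcard := VonZurGathen.card_le_height_ker_aeval (K := ℚ) (L := ℚ) (0 : Fin 3 → ℚ)
      Finset.univ (fun _ _ => rfl)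
    rw [Finset.card_univ, Fintype.card_fin] at hcard
    exact hcard.trans (Ideal.height_mono hle)

/-- Stub D of `nagata-corner-subpermanent` with the hypothesis "`a j₂` regular modulo `a j₁`"
DROPPED. [folklore] -/
def LinearFormPrimeWithoutRegular : Prop :=
  ∀ (D : Type) [CommRing D] [IsDomain D] (ι : Type) [Fintype ι] (a : ι → D) (j₁ j₂ : ι),
    j₁ ≠ j₂ → a j₁ ≠ 0 →
    (Ideal.span ({∑ j : ι, C (a j) * X j} : Set (MvPolynomial ι D))).IsPrime

/-- **The regularity of a second coefficient is load-bearing in stub D.** Over `D = ℚ[t]`, the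
linear form `t·y₀ + t·y₁ = t (y₀ + y₁)` is not prime: `t ∉ (L)` (set `y = 0`) and `y₀ + y₁ ∉ (L)`
(set `t = 0`). [folklore] -/
theorem linearFormPrime_false_without_regular : ¬ LinearFormPrimeWithoutRegular := by
  intro h
  have hP := h (Polynomial ℚ) (Fin 2) (fun _ => Polynomial.X) 0 1 (by decide) Polynomial.X_ne_zero
  set L : MvPolynomial (Fin 2) (Polynomial ℚ) := ∑ j : Fin 2, C ((fun _ => Polynomial.X) j) * X j
    with hLdef
  have hL : L = C Polynomial.X * (X 0 + X 1) := by
    rw [hLdef, Fin.sum_univ_two]; ring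
  have hmem : C Polynomial.X * (X 0 + X 1) ∈ Ideal.span {L} := by
    rw [← hL]; exact Ideal.mem_span_singleton_self L
  rcases hP.mem_or_mem hmem with ht | hy
  · -- t ∉ (L): kill the variables y
    refine not_mem_span_of_map ((aeval (R := Polynomial ℚ) (0 : Fin 2 → Polynomial ℚ)).toRingHom)
      ?_ ?_ ht
    · rintro g rfl
      simp [hL]
    · simp [Polynomial.X_ne_zero]
  · -- y₀ + y₁ ∉ (L): kill t
    refine not_mem_span_of_map (MvPolynomial.map (Polynomial.evalRingHom (0 : ℚ))) ?_ ?_ hy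
    · rintro g rfl
      simp [hL]
    · intro h0
      have h1 := congrArg (eval (![1, 0] : Fin 2 → ℚ)) h0
      simp at h1

end GeneralStubBoundaries

/-! ## 13. The threshold of `stub_missingPartial` cannot exceed `2n - 2` (window at `n = 3`: `{4, 5}`)

`stub_missingPartial` asks: primes of `S_n` of height `≤ 3` miss a partial.  How far can `3` be
pushed?  The prime `P = (x̄_0•, x̄_1•) ⊂ S_n` (rows `0, 1`; the image of gen-2's `Qrows`) contains
every partial and has height `≤ 2n - 1`: above it sits a chain of `n² - 2n` primes of `S_n` (kill the
remaining variables one at a time; all are kernels of `S_n → ℂ[x]`), and `dim S_n ≤ n² - 1`.  So the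
threshold is `< 2n - 1`; at `n = 3`: `≤ 3` TRUE (vzG, the stub), `≤ 5` FALSE (below), `≤ 4` true by
Laubenbacher–Swanson's decomposition of `V(2 × 2 subpermanents)` (all components of codim 6; not in
tree).  In particular the stub cannot be "simplified" to all primes of height `≤ dim - 4`. -/

section StubOneWindow

open scoped Classical
open Literature.Computability.AlgebraicComplexity.VonZurGathen

variable (K : Type*) [Field K] (n : ℕ)

/-- Killing a set of variables containing rows `0, 1` kills `per_n` (`n ≥ 1`). [folklore] -/
theorem killVars_perPoly_of_subset {T : Set (Fin n × Fin n)} (hT : rows01 n ⊆ T) (hn : 1 ≤ n) :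
    killVars (K := K) T (perPoly (Fin n) K) = 0 := by
  unfold perPoly Matrix.permanent
  rw [map_sum]
  refine Finset.sum_eq_zero fun σ _ => ?_
  rw [map_prod]
  refine Finset.prod_eq_zero (Finset.mem_univ (σ.symm ⟨0, hn⟩)) ?_
  have hmem : ((⟨0, hn⟩ : Fin n), σ.symm ⟨0, hn⟩) ∈ T := hT (by simp)
  simp [Matrix.mvPolynomialX, hmem]

/-- The substitution `x_p ↦ 0 (p ∈ T)` descends to `S_n → K[x]` when `T ⊇ rows 0,1`. [folklore] -/
def killS {T : Set (Fin n × Fin n)} (hT : rows01 n ⊆ T) (hn : 1 ≤ n) : S K n →ₐ[K] R K n :=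
  Ideal.Quotient.liftₐ (perIdeal K n) (killVars (K := K) T) fun a ha => by
    obtain ⟨r, rfl⟩ := Ideal.mem_span_singleton'.mp ha
    rw [map_mul, killVars_perPoly_of_subset K n hT hn, mul_zero]

@[simp] theorem killS_mk {T : Set (Fin n × Fin n)} (hT : rows01 n ⊆ T) (hn : 1 ≤ n) (f : R K n) :
    killS K n hT hn (Ideal.Quotient.mk (perIdeal K n) f) = killVars (K := K) T f :=
  rfl

/-- `P_T = ker (S_n → K[x], x̄_p ↦ 0 for p ∈ T)`, a prime of `S_n` (`T ⊇ rows 0,1`). [folklore] -/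
def PT {T : Set (Fin n × Fin n)} (hT : rows01 n ⊆ T) (hn : 1 ≤ n) : Ideal (S K n) :=
  RingHom.ker (killS K n hT hn)

instance PT_isPrime {T : Set (Fin n × Fin n)} (hT : rows01 n ⊆ T) (hn : 1 ≤ n) :
    (PT K n hT hn).IsPrime :=
  RingHom.ker_isPrime _

/-- Upstairs `P_T` is the variable ideal `(x_p : p ∈ T)`. [folklore] -/
theorem comap_PT {T : Set (Fin n × Fin n)} (hT : rows01 n ⊆ T) (hn : 1 ≤ n) :
    (PT K n hT hn).comap (Ideal.Quotient.mk (perIdeal K n)) = Ideal.span (X '' T) := by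
  ext f
  rw [Ideal.mem_comap, PT, RingHom.mem_ker, killS_mk, ← ker_killVars (K := K) T, RingHom.mem_ker]

theorem PT_eq_map {T : Set (Fin n × Fin n)} (hT : rows01 n ⊆ T) (hn : 1 ≤ n) :
    PT K n hT hn = (Ideal.span (X '' T)).map (Ideal.Quotient.mk (perIdeal K n)) := by
  rw [← comap_PT K n hT hn, Ideal.map_comap_of_surjective _ Ideal.Quotient.mk_surjective]

theorem xbar_mem_PT_iff {T : Set (Fin n × Fin n)} (hT : rows01 n ⊆ T) (hn : 1 ≤ n)
    (p : Fin n × Fin n) : xbar K p ∈ PT K n hT hn ↔ p ∈ T := by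
  rw [PT, RingHom.mem_ker, xbar, killS_mk, killVars_X]
  constructor
  · intro h
    by_contra hp
    rw [if_neg hp] at h
    exact X_ne_zero _ h
  · intro hp
    rw [if_pos hp]

/-- Enlarging `T` by a new variable gives a strictly larger prime. [folklore] -/
theorem PT_lt_PT {T T' : Set (Fin n × Fin n)} (hT : rows01 n ⊆ T) (hn : 1 ≤ n) (hTT' : T ⊆ T')
    {p : Fin n × Fin n} (hp : p ∈ T') (hp' : p ∉ T) :
    PT K n hT hn < PT K n (hT.trans hTT') hn := by
  refine lt_of_le_of_ne ?_ ?_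
  · rw [PT_eq_map K n hT hn, PT_eq_map K n (hT.trans hTT') hn]
    exact Ideal.map_mono (Ideal.span_mono (Set.image_mono hTT'))
  · intro heq
    have h := (xbar_mem_PT_iff K n (hT.trans hTT') hn p).mpr hp
    rw [← heq, xbar_mem_PT_iff] at h
    exact hp' h

/-- The primes above `P_{rows01}` obtained by killing, in addition, a finite set `U` of other
variables: `height` grows by `|U|`. [folklore] -/
theorem height_PT_add_card_le (hn : 1 ≤ n) (U : Finset (Fin n × Fin n))
    (hU : ∀ p ∈ U, p ∉ rows01 n) :
    (PT K n (T := rows01 n) subset_rfl hn).height + U.card ≤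
      (PT K n (T := rows01 n ∪ ↑U) Set.subset_union_left hn).height := by
  induction U using Finset.induction_on with
  | empty => simp
  | @insert p U hpU ih =>
    have hU' : ∀ q ∈ U, q ∉ rows01 n := fun q hq => hU q (Finset.mem_insert_of_mem hq)
    have hp : p ∉ rows01 n := hU p (Finset.mem_insert_self _ _)
    have hlt : PT K n (T := rows01 n ∪ ↑U) Set.subset_union_left hn <
        PT K n (T := rows01 n ∪ ↑(insert p U)) Set.subset_union_left hn := by
      have hsub : rows01 n ∪ (↑U : Set (Fin n × Fin n)) ⊆ rows01 n ∪ ↑(insert p U) := by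
        intro q hq
        rcases hq with hq | hq
        · exact Or.inl hq
        · exact Or.inr (Finset.mem_coe.mpr (Finset.mem_insert_of_mem (Finset.mem_coe.mp hq)))
      refine PT_lt_PT K n Set.subset_union_left hn hsub (p := p) ?_ ?_
      · exact Or.inr (Finset.mem_coe.mpr (Finset.mem_insert_self _ _))
      · rintro (hq | hq)
        · exact hp hq
        · exact hpU (Finset.mem_coe.mp hq)
    have hstep := Ideal.height_add_one_le_of_lt_of_isPrime hlt
    rw [Finset.card_insert_of_notMem hpU, Nat.cast_succ, ← add_assoc]
    exact (add_le_add (ih hU') le_rfl).trans hstep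

/-- `dim S_n ≤ n² - 1`: every prime of `S_n` has height `≤ n² - 1` (`n ≥ 1`). [folklore] -/
theorem height_le_of_isPrime_S (hn : 1 ≤ n) (P : Ideal (S K n)) [P.IsPrime] :
    P.height + 1 ≤ (n * n : ℕ) := by
  haveI : IsDomain (S K n) := isDomain_S K hn
  have h0 : (0 : WithBot ℕ∞) ≤ ringKrullDim (S K n) := ringKrullDim_nonneg_of_nontrivial
  have hne : ringKrullDim (S K n) ≠ ⊥ := by
    intro h
    rw [h] at h0
    exact WithBot.not_coe_le_bot 0 h0
  obtain ⟨d, hd⟩ := WithBot.ne_bot_iff_exists.mp hne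
  have h1 : (P.height : WithBot ℕ∞) ≤ ringKrullDim (S K n) := Ideal.height_le_ringKrullDim_of_isPrime
  have h2 : ringKrullDim (S K n) + 1 ≤ ringKrullDim (R K n) :=
    ringKrullDim_quotient_succ_le_of_nonZeroDivisor
      (mem_nonZeroDivisors_of_ne_zero (perPoly_prime K hn).ne_zero)
  have h3 : ringKrullDim (R K n) = ((n * n : ℕ) : WithBot ℕ∞) := by
    rw [MvPolynomial.ringKrullDim_of_isNoetherianRing, ringKrullDim_eq_zero_of_field]
    simp
  rw [← hd] at h1 h2
  rw [h3] at h2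
  have h1' : P.height ≤ d := WithBot.coe_le_coe.mp h1
  have h2' : d + 1 ≤ (n * n : ℕ) := by
    rw [← WithBot.coe_one, ← WithBot.coe_add] at h2
    exact WithBot.coe_le_coe.mp h2
  exact (add_le_add h1' le_rfl).trans h2'

/-- The set of variables outside rows `0, 1`. [folklore] -/
def restVars : Finset (Fin n × Fin n) := Finset.univ.filter fun p => ¬ ((p.1 : ℕ) < 2)

theorem card_restVars_add (hn : 2 ≤ n) : (restVars n).card + 2 * n ≥ n * n := by
  -- |rows01| ≤ 2n and |rows01| + |rest| = n²
  have hsum := Finset.card_filter_add_card_filter_not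
    (s := (Finset.univ : Finset (Fin n × Fin n))) (p := fun p => (p.1 : ℕ) < 2)
  rw [Finset.card_univ, Fintype.card_prod, Fintype.card_fin] at hsum
  have hrows : ((Finset.univ : Finset (Fin n × Fin n)).filter fun p => (p.1 : ℕ) < 2).card ≤ 2 * n := by
    have hsub : ((Finset.univ : Finset (Fin n × Fin n)).filter fun p => (p.1 : ℕ) < 2) ⊆
        (Finset.univ : Finset (Fin 2 × Fin n)).image
          fun a => (((⟨(a.1 : ℕ), by omega⟩ : Fin n)), a.2) := by
      intro q hq
      rw [Finset.mem_filter] at hq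
      rw [Finset.mem_image]
      exact ⟨(⟨(q.1 : ℕ), hq.2⟩, q.2), Finset.mem_univ _, by ext <;> simp⟩
    calc _ ≤ _ := Finset.card_le_card hsub
      _ ≤ (Finset.univ : Finset (Fin 2 × Fin n)).card := Finset.card_image_le
      _ = 2 * n := by rw [Finset.card_univ, Fintype.card_prod, Fintype.card_fin, Fintype.card_fin]
  have : (restVars n).card = ((Finset.univ : Finset (Fin n × Fin n)).filter
      fun p => ¬ (p.1 : ℕ) < 2).card := rfl
  omega

/-- **The witness:** `P = (x̄_0•, x̄_1•) ⊂ S_n` is a prime of height `≤ 2n - 1` whose preimage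
contains every partial `∂per_n/∂x_ij` (`n ≥ 2`). [folklore] -/
theorem exists_prime_allPartials_height_le (hn : 2 ≤ n) :
    ∃ P : Ideal (S K n), P.IsPrime ∧ P.height ≤ (2 * n - 1 : ℕ) ∧
      ∀ ij : Fin n × Fin n,
        pderiv ij (perPoly (Fin n) K) ∈ P.comap (Ideal.Quotient.mk (perIdeal K n)) := by
  have hn1 : 1 ≤ n := by omega
  refine ⟨PT K n (T := rows01 n) subset_rfl hn1, inferInstance, ?_, ?_⟩
  · -- height bookkeeping: ht P + |rest| ≤ ht P_top ≤ dim S_n ≤ n² - 1, |rest| ≥ n² - 2n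
    have hchain := height_PT_add_card_le K n hn1 (restVars n) (fun p hp => by
      rw [restVars, Finset.mem_filter] at hp
      rw [mem_rows01]
      exact hp.2)
    have htop := height_le_of_isPrime_S K n hn1
      (PT K n (T := rows01 n ∪ ↑(restVars n)) Set.subset_union_left hn1)
    have hcard := card_restVars_add n hn
    set h := (PT K n (T := rows01 n) subset_rfl hn1).height with hh
    have hfin : h ≠ ⊤ := by
      intro ht
      rw [ht, top_add] at hchain
      have h1 := top_le_iff.mp hchain
      rw [h1, top_add] at htop
      exact ENat.coe_ne_top _ (top_le_iff.mp htop)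
    obtain ⟨k, hk⟩ := ENat.ne_top_iff_exists.mp hfin
    rw [← hk] at hchain ⊢
    -- now everything is finite
    set h' := (PT K n (T := rows01 n ∪ ↑(restVars n)) Set.subset_union_left hn1).height with hh'
    have hfin' : h' ≠ ⊤ := by
      intro ht
      rw [ht, top_add] at htop
      exact ENat.coe_ne_top _ (top_le_iff.mp htop)
    obtain ⟨k', hk'⟩ := ENat.ne_top_iff_exists.mp hfin'
    rw [← hk'] at hchain htop
    have e1 : k + (restVars n).card ≤ k' := by exact_mod_cast hchain
    have e2 : k' + 1 ≤ n * n := by exact_mod_cast htop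
    have e3 : k ≤ 2 * n - 1 := by omega
    exact_mod_cast e3
  · intro ij
    rw [comap_PT]
    exact singPermIdeal_le_Qrows K n hn (pderiv_perPoly_mem_singPermIdeal K n ij)

/-- `stub_missingPartial` with its threshold `3` replaced by a parameter `k`. [folklore] -/
def MissingPartialAtHeight (n k : ℕ) : Prop :=
  ∀ (P : Ideal (MvPolynomial (Fin n × Fin n) ℂ ⧸ Ideal.span {perPoly (Fin n) ℂ})) [P.IsPrime],
    P.height ≤ k →
      ∃ ij : Fin n × Fin n, pderiv ij (perPoly (Fin n) ℂ) ∉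
        P.comap (Ideal.Quotient.mk (Ideal.span {perPoly (Fin n) ℂ}))

/-- The lead's stub is the case `k = 3`. [folklore] -/
theorem missingPartialAt_eq (n : ℕ) : MissingPartialAt n = MissingPartialAtHeight n 3 := rfl

/-- **The threshold cannot reach `2n - 1`:** for every `n ≥ 2` the statement with `k = 2n - 1`
is false (at `n = 3`: `k = 5` fails, `k = 3` is the true stub, `k = 4` is true but not proved here). [folklore] -/
theorem missingPartialAtHeight_false (n : ℕ) (hn : 2 ≤ n) : ¬ MissingPartialAtHeight n (2 * n - 1) := by
  intro h
  obtain ⟨P, hP, hht, hall⟩ := exists_prime_allPartials_height_le ℂ n hn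
  haveI := hP
  obtain ⟨ij, hij⟩ := h P hht
  exact hij (hall ij)

/-- At `n = 3`: primes of height `≤ 5` need not miss a partial. [folklore] -/
theorem missingPartialAtHeight_three_five_false : ¬ MissingPartialAtHeight 3 5 :=
  missingPartialAtHeight_false 3 (by norm_num)

end StubOneWindow

/-! ## 14. The field is load-bearing: in characteristic two `S_3` is NOT factorial

(c)-type refutation of the natural strengthening "the crux over every field": for `char K = 2`,
`per₃ = det₃` and `K[x]/(det₃)` has the non-principal height-one prime `P = I₂(rows 1,2)/(det₃)`
(Bruns–Vetter's generator of `Cl = ℤ`).  Formal route avoiding determinantal primality: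
* Stage 1: `P := ker Φ`, `Φ : S_3 → K[x]` the descent of `x_{1j} ↦ s v_j, x_{2j} ↦ t v_j` (rows `1,2`
  made proportional; kills `per₃` exactly in characteristic two); seven kernels strictly above `P`
  + `dim S_3 ≤ 8` give `ht P ≤ 1` (`height_PD_zero_le_one`).
* Stage 2: two-jets `J_{a,b} : S_3 → K[η][ε]`, `x_p ↦ a_p ε + b_p η` (cubics die, so they descend);
  component calculus `c00, c01, c10, c11`; `c10 ∘ J = ` first-order tangent map (`c10_Jhom`).
* Stage 3: `P` is not principal (`PD_zero_ne_span_singleton`, a SECOND-ORDER tangent obstruction on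
  the polar forms of the three `2 × 2` subpermanents of rows `1,2`), hence by Kaplansky
  `not_ufm_S_three_charTwo : ¬ UniqueFactorizationMonoid (S K 3)` and
  `permHypersurfaceFactorialOver_false_of_charTwo`. -/

section CharTwoNotUFD

open scoped Classical

variable (K : Type*) [Field K]

/-! ### Stage 1: the determinantal prime `P = I₂(rows 1,2)/(per₃)` as a kernel, and `ht P ≤ 1` -/

/-- Images of the variables under `φ`: row `0` kept, rows `1, 2` made proportional
(`x_{1j} ↦ s v_j`, `x_{2j} ↦ t v_j` with `s = x₁₀`, `t = x₁₁`, `v_j = x_{2j}`). [folklore] -/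
def phiFun (p : Fin 3 × Fin 3) : R K 3 :=
  if (p.1 : ℕ) = 0 then X p else if (p.1 : ℕ) = 1 then X (1, 0) * X (2, p.2) else X (1, 1) * X (2, p.2)

/-- `φ : K[x] → K[x]`. [folklore] -/
def phi : R K 3 →ₐ[K] R K 3 := aeval (phiFun K)

@[simp] theorem phi_X (p : Fin 3 × Fin 3) : phi K (X p) = phiFun K p := aeval_X _ _

/-- In characteristic two a matrix with two proportional rows has permanent `0`: `φ(per₃) = 0`. [folklore] -/
theorem phi_perPoly [CharP K 2] : phi K (perPoly (Fin 3) K) = 0 := by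
  have h2 : (2 : R K 3) = 0 := by
    have := CharP.cast_eq_zero (R K 3) 2
    simpa using this
  rw [perPoly_three]
  simp [phiFun]
  linear_combination (X (1, 0) * X (1, 1) * (X (0, 0) * X (2, 1) * X (2, 2) +
    X (0, 1) * X (2, 0) * X (2, 2) + X (0, 2) * X (2, 0) * X (2, 1))) * h2

/-- Killing more variables factors through killing fewer. [folklore] -/
theorem killVars_comp_killVars {σ : Type*} {T T' : Set σ} (h : T ⊆ T') :
    (killVars (K := K) T').comp (killVars (K := K) T) = killVars (K := K) T' := by
  apply MvPolynomial.algHom_ext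
  intro p
  simp only [AlgHom.comp_apply, killVars_X]
  by_cases hp : p ∈ T
  · rw [if_pos hp, map_zero, if_pos (h hp)]
  · rw [if_neg hp, killVars_X]

/-- Every prime of `S_3` has height `≤ 8` (`dim S_3 + 1 ≤ dim K[x_{3×3}] = 9`). [folklore] -/
theorem height_succ_le_nine (P : Ideal (S K 3)) [P.IsPrime] : P.height + 1 ≤ 9 := by
  haveI : IsDomain (S K 3) := isDomain_S K (by norm_num)
  have h0 : (0 : WithBot ℕ∞) ≤ ringKrullDim (S K 3) := ringKrullDim_nonneg_of_nontrivial
  have hne : ringKrullDim (S K 3) ≠ ⊥ := by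
    intro h
    rw [h] at h0
    exact WithBot.not_coe_le_bot 0 h0
  obtain ⟨d, hd⟩ := WithBot.ne_bot_iff_exists.mp hne
  have h1 : (P.height : WithBot ℕ∞) ≤ ringKrullDim (S K 3) := Ideal.height_le_ringKrullDim_of_isPrime
  have h2 : ringKrullDim (S K 3) + 1 ≤ ringKrullDim (R K 3) :=
    ringKrullDim_quotient_succ_le_of_nonZeroDivisor
      (mem_nonZeroDivisors_of_ne_zero (perPoly_prime K (n := 3) (by norm_num)).ne_zero)
  have h3 : ringKrullDim (R K 3) = ((9 : ℕ∞) : WithBot ℕ∞) := by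
    rw [MvPolynomial.ringKrullDim_of_isNoetherianRing, ringKrullDim_eq_zero_of_field]
    simp
  rw [← hd] at h1 h2
  rw [h3] at h2
  have h1' : P.height ≤ d := WithBot.coe_le_coe.mp h1
  have h2' : d + 1 ≤ 9 := by
    rw [← WithBot.coe_one, ← WithBot.coe_add] at h2
    exact WithBot.coe_le_coe.mp h2
  exact (add_le_add h1' le_rfl).trans h2'

variable [CharP K 2]

/-- `Φ : S_3 → K[x]`, the descent of `φ`. [folklore] -/
def Phi : S K 3 →ₐ[K] R K 3 :=
  Ideal.Quotient.liftₐ (perIdeal K 3) (phi K) fun a ha => by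
    obtain ⟨r, rfl⟩ := Ideal.mem_span_singleton'.mp ha
    rw [map_mul, phi_perPoly, mul_zero]

@[simp] theorem Phi_mk (f : R K 3) : Phi K (Ideal.Quotient.mk (perIdeal K 3) f) = phi K f := rfl

/-- `P_T = ker (kill T ∘ Φ) ⊂ S_3`, prime. [folklore] -/
def PD (T : Set (Fin 3 × Fin 3)) : Ideal (S K 3) :=
  RingHom.ker ((killVars (K := K) T).comp (Phi K))

instance PD_isPrime (T : Set (Fin 3 × Fin 3)) : (PD K T).IsPrime := RingHom.ker_isPrime _

theorem mem_PD_mk (T : Set (Fin 3 × Fin 3)) (f : R K 3) :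
    Ideal.Quotient.mk (perIdeal K 3) f ∈ PD K T ↔ killVars (K := K) T (phi K f) = 0 := by
  rw [PD, RingHom.mem_ker]
  rfl

theorem PD_mono {T T' : Set (Fin 3 × Fin 3)} (h : T ⊆ T') : PD K T ≤ PD K T' := by
  intro z hz
  obtain ⟨f, rfl⟩ := Ideal.Quotient.mk_surjective z
  rw [mem_PD_mk] at hz ⊢
  rw [← killVars_comp_killVars K h, AlgHom.comp_apply, hz, map_zero]

/-- The chain of variables killed above `P`: `v₂, v₁, t, s, y₀, y₁, y₂`. [folklore] -/
def chainList : List (Fin 3 × Fin 3) := [(2, 2), (2, 1), (1, 1), (1, 0), (0, 0), (0, 1), (0, 2)]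

/-- `T_k` = the first `k` killed variables. [folklore] -/
def Tk (k : ℕ) : Set (Fin 3 × Fin 3) := {p | p ∈ chainList.take k}

theorem Tk_mono {k l : ℕ} (h : k ≤ l) : Tk k ⊆ Tk l := fun _ hp =>
  (List.take_prefix_take_left h).subset hp

/-- The witness of strictness at step `k`: `x̄_{w_k} ∈ P_{k+1} ∖ P_k`. [folklore] -/
theorem PD_strict (k : Fin 7) : PD K (Tk k) < PD K (Tk (k + 1)) := by
  refine lt_of_le_of_ne (PD_mono K (Tk_mono (Nat.le_succ _))) ?_
  intro heq
  have key : ∀ p : Fin 3 × Fin 3, xbar K p ∈ PD K (Tk (k + 1)) → xbar K p ∈ PD K (Tk k) := by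
    intro p hp; rwa [heq]
  fin_cases k
  · have h := key (1, 2) (by rw [xbar, mem_PD_mk]; simp [phiFun, Tk, chainList])
    rw [xbar, mem_PD_mk] at h
    simp [phiFun, Tk, chainList] at h
  · have h := key (1, 1) (by rw [xbar, mem_PD_mk]; simp [phiFun, Tk, chainList])
    rw [xbar, mem_PD_mk] at h
    simp [phiFun, Tk, chainList] at h
  · have h := key (2, 0) (by rw [xbar, mem_PD_mk]; simp [phiFun, Tk, chainList])
    rw [xbar, mem_PD_mk] at h
    simp [phiFun, Tk, chainList] at h
  · have h := key (1, 0) (by rw [xbar, mem_PD_mk]; simp [phiFun, Tk, chainList])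
    rw [xbar, mem_PD_mk] at h
    simp [phiFun, Tk, chainList] at h
  · have h := key (0, 0) (by rw [xbar, mem_PD_mk]; simp [phiFun, Tk, chainList])
    rw [xbar, mem_PD_mk] at h
    simp [phiFun, Tk, chainList] at h
  · have h := key (0, 1) (by rw [xbar, mem_PD_mk]; simp [phiFun, Tk, chainList])
    rw [xbar, mem_PD_mk] at h
    simp [phiFun, Tk, chainList] at h
  · have h := key (0, 2) (by rw [xbar, mem_PD_mk]; simp [phiFun, Tk, chainList])
    rw [xbar, mem_PD_mk] at h
    simp [phiFun, Tk, chainList] at h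

/-- **`ht P ≤ 1`** for `P = P_∅ = ker Φ` (seven primes sit strictly above it). [folklore] -/
theorem height_PD_zero_le_one : (PD K (Tk 0)).height ≤ 1 := by
  have hchain : ∀ k : ℕ, k ≤ 7 → (PD K (Tk 0)).height + k ≤ (PD K (Tk k)).height := by
    intro k hk
    induction k with
    | zero => simp
    | succ k ih =>
      have ih' := ih (by omega)
      have hlt := PD_strict K ⟨k, by omega⟩
      have hstep := Ideal.height_add_one_le_of_lt_of_isPrime hlt
      push_cast
      rw [← add_assoc]
      exact (add_le_add ih' le_rfl).trans hstep
  have h7 := hchain 7 le_rfl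
  have htop := height_succ_le_nine K (PD K (Tk 7))
  set h := (PD K (Tk 0)).height with hh
  have hfin : h ≠ ⊤ := by
    intro ht
    rw [ht, top_add] at h7
    have h1 := top_le_iff.mp h7
    rw [h1, top_add] at htop
    exact absurd htop (by decide)
  obtain ⟨k, hk⟩ := ENat.ne_top_iff_exists.mp hfin
  rw [← hk] at h7 ⊢
  have hfin' : (PD K (Tk 7)).height ≠ ⊤ := by
    intro ht
    rw [ht, top_add] at htop
    exact absurd htop (by decide)
  obtain ⟨k', hk'⟩ := ENat.ne_top_iff_exists.mp hfin'
  rw [← hk'] at h7 htop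
  have e1 : k + 7 ≤ k' := by exact_mod_cast h7
  have e2 : k' + 1 ≤ 9 := by exact_mod_cast htop
  have e3 : k ≤ 1 := by omega
  exact_mod_cast e3

end CharTwoNotUFD

/-! ### Stage 2: two-jets.  `A = K[η][ε]` (`ε² = η² = 0`, `εη ≠ 0`); cubics die in `A`, so every
`J_{a,b} : x_p ↦ a_p ε + b_p η` descends to `S_3`; the four components of a two-jet. -/

section TwoJets

variable (K : Type*) [Field K]

/-- The algebra of two-jets in two directions, `K[η][ε]`. [folklore] -/
abbrev A2 : Type _ := DualNumber (DualNumber K)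

/-- constant term -/
def c00 (z : A2 K) : K := z.fst.fst
/-- `η`-coefficient -/
def c01 (z : A2 K) : K := z.fst.snd
/-- `ε`-coefficient -/
def c10 (z : A2 K) : K := z.snd.fst
/-- `εη`-coefficient -/
def c11 (z : A2 K) : K := z.snd.snd

variable {K}

omit [Field K] in
theorem A2_ext {z w : A2 K} (h00 : c00 K z = c00 K w) (h01 : c01 K z = c01 K w)
    (h10 : c10 K z = c10 K w) (h11 : c11 K z = c11 K w) : z = w :=
  TrivSqZeroExt.ext (TrivSqZeroExt.ext h00 h01) (TrivSqZeroExt.ext h10 h11)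

@[simp] theorem c00_mul (z w : A2 K) : c00 K (z * w) = c00 K z * c00 K w := by
  simp [c00, TrivSqZeroExt.fst_mul]

@[simp] theorem c01_mul (z w : A2 K) : c01 K (z * w) = c00 K z * c01 K w + c01 K z * c00 K w := by
  simp [c00, c01, TrivSqZeroExt.fst_mul]

@[simp] theorem c10_mul (z w : A2 K) : c10 K (z * w) = c00 K z * c10 K w + c10 K z * c00 K w := by
  simp [c00, c10, TrivSqZeroExt.fst_mul, TrivSqZeroExt.fst_add]

@[simp] theorem c11_mul (z w : A2 K) :
    c11 K (z * w) = c00 K z * c11 K w + c01 K z * c10 K w + c10 K z * c01 K w + c11 K z * c00 K w := by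
  simp [c00, c01, c10, c11, TrivSqZeroExt.snd_add]
  ring

@[simp] theorem c00_add (z w : A2 K) : c00 K (z + w) = c00 K z + c00 K w := rfl
@[simp] theorem c01_add (z w : A2 K) : c01 K (z + w) = c01 K z + c01 K w := rfl
@[simp] theorem c10_add (z w : A2 K) : c10 K (z + w) = c10 K z + c10 K w := rfl
@[simp] theorem c11_add (z w : A2 K) : c11 K (z + w) = c11 K z + c11 K w := rfl
@[simp] theorem c00_zero : c00 K (0 : A2 K) = 0 := rfl
@[simp] theorem c01_zero : c01 K (0 : A2 K) = 0 := rfl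
@[simp] theorem c10_zero : c10 K (0 : A2 K) = 0 := rfl
@[simp] theorem c11_zero : c11 K (0 : A2 K) = 0 := rfl

variable (K)

/-- Scalars `K → A`. [folklore] -/
def cK : K →+* A2 K := (algebraMap (DualNumber K) (A2 K)).comp (algebraMap K (DualNumber K))

/-- outer `ε` -/
def epsO : A2 K := DualNumber.eps
/-- inner `η` -/
def etaI : A2 K := algebraMap (DualNumber K) (A2 K) DualNumber.eps

@[simp] theorem c00_cK (k : K) : c00 K (cK K k) = k := rfl
@[simp] theorem c01_cK (k : K) : c01 K (cK K k) = 0 := rfl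
@[simp] theorem c10_cK (k : K) : c10 K (cK K k) = 0 := rfl
@[simp] theorem c11_cK (k : K) : c11 K (cK K k) = 0 := rfl
@[simp] theorem c00_epsO : c00 K (epsO K) = 0 := rfl
@[simp] theorem c01_epsO : c01 K (epsO K) = 0 := rfl
@[simp] theorem c10_epsO : c10 K (epsO K) = 1 := rfl
@[simp] theorem c11_epsO : c11 K (epsO K) = 0 := rfl
@[simp] theorem c00_etaI : c00 K (etaI K) = 0 := rfl
@[simp] theorem c01_etaI : c01 K (etaI K) = 1 := rfl
@[simp] theorem c10_etaI : c10 K (etaI K) = 0 := rfl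
@[simp] theorem c11_etaI : c11 K (etaI K) = 0 := rfl

/-- Three elements without constant term multiply to zero in `A`. [folklore] -/
theorem mul3_eq_zero {u v w : A2 K} (hu : c00 K u = 0) (hv : c00 K v = 0) (hw : c00 K w = 0) :
    u * v * w = 0 := by
  apply A2_ext <;> simp [hu, hv, hw]

/-- The two-jet map `J_{a,b} : K[x] → A`, `x_p ↦ a_p ε + b_p η`. [folklore] -/
def Jhom (a b : Fin 3 × Fin 3 → K) : R K 3 →+* A2 K :=
  eval₂Hom (cK K) fun p => cK K (a p) * epsO K + cK K (b p) * etaI K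

@[simp] theorem Jhom_X (a b : Fin 3 × Fin 3 → K) (p : Fin 3 × Fin 3) :
    Jhom K a b (X p) = cK K (a p) * epsO K + cK K (b p) * etaI K :=
  eval₂Hom_X' _ _ _

@[simp] theorem Jhom_C (a b : Fin 3 × Fin 3 → K) (k : K) : Jhom K a b (C k) = cK K k :=
  eval₂Hom_C _ _ _

theorem c00_Jhom_X (a b : Fin 3 × Fin 3 → K) (p : Fin 3 × Fin 3) : c00 K (Jhom K a b (X p)) = 0 := by
  simp

/-- `J(per₃) = 0`: the permanent is a sum of triple products of variables. [folklore] -/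
theorem Jhom_perPoly (a b : Fin 3 × Fin 3 → K) : Jhom K a b (perPoly (Fin 3) K) = 0 := by
  have h3 : ∀ p q r : Fin 3 × Fin 3,
      Jhom K a b (X p) * (Jhom K a b (X q) * Jhom K a b (X r)) = 0 := by
    intro p q r
    rw [← mul_assoc]
    exact mul3_eq_zero K (c00_Jhom_X K a b p) (c00_Jhom_X K a b q) (c00_Jhom_X K a b r)
  rw [perPoly_three]
  simp only [map_add, map_mul, mul_add, h3, add_zero]

/-- The descent `J_{a,b} : S_3 → A`. [folklore] -/
def JS (a b : Fin 3 × Fin 3 → K) : S K 3 →+* A2 K :=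
  Ideal.Quotient.lift (perIdeal K 3) (Jhom K a b) fun f hf => by
    obtain ⟨r, rfl⟩ := Ideal.mem_span_singleton'.mp hf
    rw [map_mul, Jhom_perPoly, mul_zero]

@[simp] theorem JS_mk (a b : Fin 3 × Fin 3 → K) (f : R K 3) :
    JS K a b (Ideal.Quotient.mk (perIdeal K 3) f) = Jhom K a b f := rfl

/-- The constant term of a two-jet is the constant coefficient. [folklore] -/
theorem c00_Jhom (a b : Fin 3 × Fin 3 → K) (f : R K 3) : c00 K (Jhom K a b f) = constantCoeff f := by
  induction f using MvPolynomial.induction_on with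
  | C k => simp
  | add p q hp hq => simp [hp, hq]
  | mul_X p i hp => simp [hp]

/-- The constant part of the first-order tangent map is the constant coefficient. [folklore] -/
theorem fst_evalEps (v : Fin 3 × Fin 3 → K) (f : R K 3) :
    TrivSqZeroExt.fst (evalEps K v f) = constantCoeff f := by
  induction f using MvPolynomial.induction_on with
  | C k => simp [evalEps, Algebra.algebraMap_eq_smul_one]
  | add p q hp hq => simp only [map_add, TrivSqZeroExt.fst_add, hp, hq]
  | mul_X p i hp => simp [hp, TrivSqZeroExt.fst_mul, evalEps_X]

/-- **The `ε`-coefficient of `J_{a,b}` is the first-order tangent map along `a`.** [folklore] -/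
theorem c10_Jhom (a b : Fin 3 × Fin 3 → K) (f : R K 3) :
    c10 K (Jhom K a b f) = TrivSqZeroExt.snd (evalEps K a f) := by
  induction f using MvPolynomial.induction_on with
  | C k => simp [evalEps, Algebra.algebraMap_eq_smul_one]
  | add p q hp hq => simp only [map_add, c10_add, TrivSqZeroExt.snd_add, hp, hq]
  | mul_X p i hp =>
    rw [map_mul, c10_mul, hp, c00_Jhom, map_mul, DualNumber.snd_mul, fst_evalEps]
    simp [evalEps_X]

/-- **The `η`-coefficient of `J_{a,b}` is the first-order tangent map along `b`.** [folklore] -/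
theorem c01_Jhom (a b : Fin 3 × Fin 3 → K) (f : R K 3) :
    c01 K (Jhom K a b f) = TrivSqZeroExt.snd (evalEps K b f) := by
  induction f using MvPolynomial.induction_on with
  | C k => simp [evalEps, Algebra.algebraMap_eq_smul_one]
  | add p q hp hq => simp only [map_add, c01_add, TrivSqZeroExt.snd_add, hp, hq]
  | mul_X p i hp =>
    rw [map_mul, c01_mul, hp, c00_Jhom, map_mul, DualNumber.snd_mul, fst_evalEps]
    simp [evalEps_X]

/-- The first-order tangent map is additive in the tangent vector … [folklore] -/
theorem snd_evalEps_add (v w : Fin 3 × Fin 3 → K) (f : R K 3) :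
    TrivSqZeroExt.snd (evalEps K (v + w) f) =
      TrivSqZeroExt.snd (evalEps K v f) + TrivSqZeroExt.snd (evalEps K w f) := by
  induction f using MvPolynomial.induction_on with
  | C k => simp [evalEps, Algebra.algebraMap_eq_smul_one]
  | add p q hp hq =>
    simp only [map_add, TrivSqZeroExt.snd_add, hp, hq]
    ring
  | mul_X p i hp =>
    simp only [map_mul, DualNumber.snd_mul, fst_evalEps, hp, evalEps_X]
    simp
    ring

/-- … and homogeneous. [folklore] -/
theorem snd_evalEps_smul (c : K) (v : Fin 3 × Fin 3 → K) (f : R K 3) :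
    TrivSqZeroExt.snd (evalEps K (c • v) f) = c * TrivSqZeroExt.snd (evalEps K v f) := by
  induction f using MvPolynomial.induction_on with
  | C k => simp [evalEps, Algebra.algebraMap_eq_smul_one]
  | add p q hp hq =>
    simp only [map_add, TrivSqZeroExt.snd_add, hp, hq]
    ring
  | mul_X p i hp =>
    simp only [map_mul, DualNumber.snd_mul, fst_evalEps, hp, evalEps_X]
    simp
    ring

end TwoJets


/-! ### Stage 3: `P` is not principal (second-order tangent obstruction), hence `S_3` is not a UFD
in characteristic two -/

section CharTwoNotUFD2

open scoped Classical

variable (K : Type*) [Field K]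

/-- The three `2 × 2` (sub)permanents of rows `1, 2`. [folklore] -/
def mA : R K 3 := X (1, 0) * X (2, 1) + X (1, 1) * X (2, 0)
/-- see `mA` -/
def mB : R K 3 := X (1, 0) * X (2, 2) + X (1, 2) * X (2, 0)
/-- see `mA` -/
def mC : R K 3 := X (1, 1) * X (2, 2) + X (1, 2) * X (2, 1)

/-- Two-jet components of a binomial quadric `x_p x_q + x_p' x_q'`. [folklore] -/
theorem c10_Jhom_quad (a b : Fin 3 × Fin 3 → K) (p q p' q' : Fin 3 × Fin 3) :
    c10 K (Jhom K a b (X p * X q + X p' * X q')) = 0 := by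
  simp

theorem c01_Jhom_quad (a b : Fin 3 × Fin 3 → K) (p q p' q' : Fin 3 × Fin 3) :
    c01 K (Jhom K a b (X p * X q + X p' * X q')) = 0 := by
  simp

/-- The `εη`-coefficient of the two-jet of `x_p x_q + x_p' x_q'` is its polar bilinear form. [folklore] -/
theorem c11_Jhom_quad (a b : Fin 3 × Fin 3 → K) (p q p' q' : Fin 3 × Fin 3) :
    c11 K (Jhom K a b (X p * X q + X p' * X q')) = a p * b q + b p * a q + (a p' * b q' + b p' * a q') := by
  simp
  ring

/-- `constantCoeff ∘ kill T ∘ φ = constantCoeff`. [folklore] -/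
theorem constantCoeff_killVars_phi (T : Set (Fin 3 × Fin 3)) (f : R K 3) :
    constantCoeff (killVars (K := K) T (phi K f)) = constantCoeff f := by
  induction f using MvPolynomial.induction_on with
  | C k => simp [phi, killVars]
  | add p q hp hq => simp only [map_add, hp, hq]
  | mul_X p i hp =>
    simp only [map_mul, hp, phi_X, constantCoeff_X, mul_zero]
    simp only [phiFun, killVars]
    split_ifs <;> simp [apply_ite constantCoeff]

variable [CharP K 2]

/-- In characteristic two `φ` kills the three subpermanents of rows `1, 2`. [folklore] -/
theorem phi_quad_eq_zero :
    phi K (mA K) = 0 ∧ phi K (mB K) = 0 ∧ phi K (mC K) = 0 := by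
  have h2 : (2 : R K 3) = 0 := by
    have := CharP.cast_eq_zero (R K 3) 2
    simpa using this
  refine ⟨?_, ?_, ?_⟩
  · simp [mA, phiFun]
    linear_combination (X (1, 0) * X (1, 1) * X (2, 0) * X (2, 1)) * h2
  · simp [mB, phiFun]
    linear_combination (X (1, 0) * X (1, 1) * X (2, 0) * X (2, 2)) * h2
  · simp [mC, phiFun]
    linear_combination (X (1, 0) * X (1, 1) * X (2, 1) * X (2, 2)) * h2

theorem mk_quad_mem_PD :
    Ideal.Quotient.mk (perIdeal K 3) (mA K) ∈ PD K (Tk 0) ∧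
      Ideal.Quotient.mk (perIdeal K 3) (mB K) ∈ PD K (Tk 0) ∧
      Ideal.Quotient.mk (perIdeal K 3) (mC K) ∈ PD K (Tk 0) := by
  obtain ⟨hA, hB, hC⟩ := phi_quad_eq_zero K
  refine ⟨?_, ?_, ?_⟩ <;> rw [mem_PD_mk] <;> simp [hA, hB, hC]

omit [CharP K 2] in
theorem mk_mC_ne_zero : Ideal.Quotient.mk (perIdeal K 3) (mC K) ≠ 0 := by
  intro h
  rw [Ideal.Quotient.eq_zero_iff_mem] at h
  refine not_mem_span_of_eval (fun p => if p = (1, 1) ∨ p = (2, 2) then 1 else 0) ?_ ?_ h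
  · rintro g rfl
    simp [perPoly_three]
  · simp [mC]

/-- Coordinate tangent vectors. [folklore] -/
abbrev ee (p : Fin 3 × Fin 3) : Fin 3 × Fin 3 → K := Pi.single p 1

omit [CharP K 2] in
theorem BC_e11_e22 : c11 K (Jhom K (ee K (1, 1)) (ee K (2, 2)) (mC K)) = 1 := by
  have h := c11_Jhom_quad K (ee K (1, 1)) (ee K (2, 2)) (1, 1) (2, 2) (1, 2) (2, 1)
  rw [show mC K = X (1, 1) * X (2, 2) + X (1, 2) * X (2, 1) from rfl, h]
  simp

omit [CharP K 2] in
theorem BA_e11_e22 : c11 K (Jhom K (ee K (1, 1)) (ee K (2, 2)) (mA K)) = 0 := by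
  have h := c11_Jhom_quad K (ee K (1, 1)) (ee K (2, 2)) (1, 0) (2, 1) (1, 1) (2, 0)
  rw [show mA K = X (1, 0) * X (2, 1) + X (1, 1) * X (2, 0) from rfl, h]
  simp

omit [CharP K 2] in
theorem BA_e10_e21 : c11 K (Jhom K (ee K (1, 0)) (ee K (2, 1)) (mA K)) = 1 := by
  have h := c11_Jhom_quad K (ee K (1, 0)) (ee K (2, 1)) (1, 0) (2, 1) (1, 1) (2, 0)
  rw [show mA K = X (1, 0) * X (2, 1) + X (1, 1) * X (2, 0) from rfl, h]
  simp

omit [CharP K 2] in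
theorem BB_e10_e22 : c11 K (Jhom K (ee K (1, 0)) (ee K (2, 2)) (mB K)) = 1 := by
  have h := c11_Jhom_quad K (ee K (1, 0)) (ee K (2, 2)) (1, 0) (2, 2) (1, 2) (2, 0)
  rw [show mB K = X (1, 0) * X (2, 2) + X (1, 2) * X (2, 0) from rfl, h]
  simp

omit [CharP K 2] in
/-- Case IIa pair: `a = L_q e₁₁ - L₁₁ e_q`, `b = L_q e₂₂ - L₂₂ e_q` with `q` off the support of `m_C`. -/
theorem BC_IIa (q : Fin 3 × Fin 3) (hq11 : q ≠ (1, 1)) (hq22 : q ≠ (2, 2)) (hq12 : q ≠ (1, 2))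
    (hq21 : q ≠ (2, 1)) (Lq L11 L22 : K) :
    c11 K (Jhom K (Lq • ee K (1, 1) + (-L11) • ee K q) (Lq • ee K (2, 2) + (-L22) • ee K q) (mC K)) =
      Lq * Lq := by
  have h := c11_Jhom_quad K (Lq • ee K (1, 1) + (-L11) • ee K q) (Lq • ee K (2, 2) + (-L22) • ee K q)
    (1, 1) (2, 2) (1, 2) (2, 1)
  rw [show mC K = X (1, 1) * X (2, 2) + X (1, 2) * X (2, 1) from rfl, h]
  simp [hq11.symm, hq22.symm, hq12.symm, hq21.symm]

omit [CharP K 2] in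
/-- Case IIb pair for `m_A`: `a = e₁₀`, `b = L₂₂ e₂₁ - L₂₁ e₂₂`. -/
theorem BA_IIb (L22 L21 : K) :
    c11 K (Jhom K (ee K (1, 0)) (L22 • ee K (2, 1) + (-L21) • ee K (2, 2)) (mA K)) = L22 := by
  have h := c11_Jhom_quad K (ee K (1, 0)) (L22 • ee K (2, 1) + (-L21) • ee K (2, 2))
    (1, 0) (2, 1) (1, 1) (2, 0)
  rw [show mA K = X (1, 0) * X (2, 1) + X (1, 1) * X (2, 0) from rfl, h]
  simp

omit [CharP K 2] in
/-- Case IIb pair for `m_B`: `a = e₁₀`, `b = L₁₁ e₂₂ - L₂₂ e₁₁`. -/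
theorem BB_IIb (L11 L22 : K) :
    c11 K (Jhom K (ee K (1, 0)) (L11 • ee K (2, 2) + (-L22) • ee K (1, 1)) (mB K)) = L11 := by
  have h := c11_Jhom_quad K (ee K (1, 0)) (L11 • ee K (2, 2) + (-L22) • ee K (1, 1))
    (1, 0) (2, 2) (1, 2) (2, 0)
  rw [show mB K = X (1, 0) * X (2, 2) + X (1, 2) * X (2, 0) from rfl, h]
  simp

omit [CharP K 2] in
theorem c10_Jhom_mA (a b : Fin 3 × Fin 3 → K) : c10 K (Jhom K a b (mA K)) = 0 :=
  c10_Jhom_quad K a b (1, 0) (2, 1) (1, 1) (2, 0)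
omit [CharP K 2] in
theorem c10_Jhom_mB (a b : Fin 3 × Fin 3 → K) : c10 K (Jhom K a b (mB K)) = 0 :=
  c10_Jhom_quad K a b (1, 0) (2, 2) (1, 2) (2, 0)
omit [CharP K 2] in
theorem c10_Jhom_mC (a b : Fin 3 × Fin 3 → K) : c10 K (Jhom K a b (mC K)) = 0 :=
  c10_Jhom_quad K a b (1, 1) (2, 2) (1, 2) (2, 1)

/-- **Second-order tangent obstruction:** `P = I₂(rows 1,2)/(per₃)` is not a principal ideal of
`S_3` (characteristic two).  If `P = (ḡ)`, write `m̄ᵢ = cᵢ ḡ` for the three subpermanents and apply the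
two-jet maps `J_{a,b}`: with `λ = dg(0)` (`ε`- and `η`-coefficients of `J ḡ`) and `κᵢ = cᵢ(0)` one
gets `κᵢ λ ≡ 0` and `Bᵢ(a,b) = κᵢ G(a,b) + μᵢ λ(a) + νᵢ λ(b)` for the polar forms `Bᵢ` of the `mᵢ`.
If `λ = 0` the three `Bᵢ` are proportional to one form `G` — impossible (`B_C(e₁₁,e₂₂) = 1`,
`B_A(e₁₁,e₂₂) = 0`, `B_A(e₁₀,e₂₁) = 1`); if `λ ≠ 0` then all `κᵢ = 0` and every `Bᵢ` vanishes on
`ker λ × ker λ` — impossible by an explicit pair in `ker λ` for each support pattern of `λ`. [folklore] -/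
theorem PD_zero_ne_span_singleton (g : S K 3) : PD K (Tk 0) ≠ Ideal.span {g} := by
  intro hP
  obtain ⟨fg, rfl⟩ := Ideal.Quotient.mk_surjective g
  obtain ⟨hmA, hmB, hmC⟩ := mk_quad_mem_PD K
  rw [hP] at hmA hmB hmC
  -- constant term of g vanishes
  have hg0 : constantCoeff fg = 0 := by
    have hmem : Ideal.Quotient.mk (perIdeal K 3) fg ∈ PD K (Tk 0) := by
      rw [hP]; exact Ideal.mem_span_singleton_self _
    rw [mem_PD_mk] at hmem
    rw [← constantCoeff_killVars_phi K (Tk 0) fg, hmem, map_zero]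
  -- the differential of g at 0, and its linearity
  set lam : (Fin 3 × Fin 3 → K) → K := fun v => TrivSqZeroExt.snd (evalEps K v fg) with hlam
  have lam_add : ∀ v w, lam (v + w) = lam v + lam w := fun v w => snd_evalEps_add K v w fg
  have lam_smul : ∀ (c : K) v, lam (c • v) = c * lam v := fun c v => snd_evalEps_smul K c v fg
  have lam_comb : ∀ (c d : K) (v w : Fin 3 × Fin 3 → K),
      lam (c • v + d • w) = c * lam v + d * lam w := by
    intro c d v w
    rw [lam_add, lam_smul, lam_smul]
  -- the master identities
  have key : ∀ mi : R K 3,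
      Ideal.Quotient.mk (perIdeal K 3) mi ∈ Ideal.span {Ideal.Quotient.mk (perIdeal K 3) fg} →
      ∃ (κ : K) (fc : R K 3), ∀ a b : Fin 3 × Fin 3 → K,
        c10 K (Jhom K a b mi) = κ * lam a ∧ c01 K (Jhom K a b mi) = κ * lam b ∧
        c11 K (Jhom K a b mi) = κ * c11 K (Jhom K a b fg) +
          TrivSqZeroExt.snd (evalEps K b fc) * lam a + TrivSqZeroExt.snd (evalEps K a fc) * lam b := by
    intro mi hmi
    obtain ⟨c, hc⟩ := Ideal.mem_span_singleton'.mp hmi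
    obtain ⟨fc, rfl⟩ := Ideal.Quotient.mk_surjective c
    refine ⟨constantCoeff fc, fc, fun a b => ?_⟩
    have h := congrArg (JS K a b) hc
    rw [← map_mul, JS_mk, JS_mk, map_mul] at h
    have e10 := congrArg (c10 K) h
    have e01 := congrArg (c01 K) h
    have e11 := congrArg (c11 K) h
    rw [c10_mul, c00_Jhom, c00_Jhom, hg0, mul_zero, add_zero, c10_Jhom] at e10
    rw [c01_mul, c00_Jhom, c00_Jhom, hg0, mul_zero, add_zero, c01_Jhom] at e01
    rw [c11_mul, c00_Jhom, c00_Jhom, hg0, mul_zero, add_zero, c10_Jhom, c01_Jhom, c10_Jhom,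
      c01_Jhom] at e11
    exact ⟨e10.symm, e01.symm, e11.symm⟩
  obtain ⟨κA, fA, hA⟩ := key (mA K) hmA
  obtain ⟨κB, fB, hB⟩ := key (mB K) hmB
  obtain ⟨κC, fC, hC⟩ := key (mC K) hmC
  by_cases hΛ : ∀ p : Fin 3 × Fin 3, lam (ee K p) = 0
  · -- Case I: dg(0) = 0, the three polar forms are proportional to G
    have h1 := (hC (ee K (1, 1)) (ee K (2, 2))).2.2
    rw [BC_e11_e22, hΛ, hΛ, mul_zero, mul_zero, add_zero, add_zero] at h1
    have h2 := (hA (ee K (1, 1)) (ee K (2, 2))).2.2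
    rw [BA_e11_e22, hΛ, hΛ, mul_zero, mul_zero, add_zero, add_zero] at h2
    have hG : c11 K (Jhom K (ee K (1, 1)) (ee K (2, 2)) fg) ≠ 0 := by
      intro h0; rw [h0, mul_zero] at h1; exact one_ne_zero h1
    have hκA : κA = 0 := by
      rcases mul_eq_zero.mp h2.symm with h | h
      · exact h
      · exact absurd h hG
    have h3 := (hA (ee K (1, 0)) (ee K (2, 1))).2.2
    rw [BA_e10_e21, hΛ, hΛ, hκA, zero_mul, mul_zero, mul_zero, add_zero, add_zero] at h3
    exact one_ne_zero h3
  · -- Case II: dg(0) ≠ 0; first all κ vanish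
    push Not at hΛ
    obtain ⟨r, hr⟩ := hΛ
    have hκ : ∀ (κ : K) (mi : R K 3), (∀ a b : Fin 3 × Fin 3 → K, c10 K (Jhom K a b mi) = κ * lam a) →
        (∀ a b : Fin 3 × Fin 3 → K, c10 K (Jhom K a b mi) = 0) → κ = 0 := by
      intro κ mi h h0
      have := h (ee K r) 0
      rw [h0] at this
      rcases mul_eq_zero.mp this.symm with h' | h'
      · exact h'
      · exact absurd h' hr
    have hκA : κA = 0 := hκ κA (mA K) (fun a b => (hA a b).1) (c10_Jhom_mA K)
    have hκB : κB = 0 := hκ κB (mB K) (fun a b => (hB a b).1) (c10_Jhom_mB K)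
    have hκC : κC = 0 := hκ κC (mC K) (fun a b => (hC a b).1) (c10_Jhom_mC K)
    by_cases hout : ∃ q : Fin 3 × Fin 3,
        (q ≠ (1, 1) ∧ q ≠ (2, 2) ∧ q ≠ (1, 2) ∧ q ≠ (2, 1)) ∧ lam (ee K q) ≠ 0
    · -- Case IIa: a nonzero coordinate of dg(0) off the support of m_C
      obtain ⟨q, ⟨hq11, hq22, hq12, hq21⟩, hq⟩ := hout
      set Lq := lam (ee K q)
      set L11 := lam (ee K (1, 1))
      set L22 := lam (ee K (2, 2))
      have ha : lam (Lq • ee K (1, 1) + (-L11) • ee K q) = 0 := by rw [lam_comb]; ring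
      have hb : lam (Lq • ee K (2, 2) + (-L22) • ee K q) = 0 := by rw [lam_comb]; ring
      have h := (hC (Lq • ee K (1, 1) + (-L11) • ee K q) (Lq • ee K (2, 2) + (-L22) • ee K q)).2.2
      rw [BC_IIa K q hq11 hq22 hq12 hq21, ha, hb, hκC, zero_mul, mul_zero, mul_zero, add_zero,
        add_zero] at h
      exact mul_ne_zero hq hq h
    · -- Case IIb: dg(0) is supported on {11, 22, 12, 21}
      push Not at hout
      have h10 : lam (ee K (1, 0)) = 0 := hout (1, 0) ⟨by decide, by decide, by decide, by decide⟩
      by_cases h22 : lam (ee K (2, 2)) = 0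
      · have h := (hB (ee K (1, 0)) (ee K (2, 2))).2.2
        rw [BB_e10_e22, h10, h22, hκB] at h
        simp at h
      · by_cases h11 : lam (ee K (1, 1)) = 0
        · have hb : lam (lam (ee K (2, 2)) • ee K (2, 1) + (-lam (ee K (2, 1))) • ee K (2, 2)) = 0 := by
            rw [lam_comb]; ring
          have h := (hA (ee K (1, 0)) (lam (ee K (2, 2)) • ee K (2, 1) + (-lam (ee K (2, 1))) • ee K (2, 2))).2.2
          rw [BA_IIb, h10, hb, hκA] at h
          simp at h
          exact h22 h
        · have hb : lam (lam (ee K (1, 1)) • ee K (2, 2) + (-lam (ee K (2, 2))) • ee K (1, 1)) = 0 := by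
            rw [lam_comb]; ring
          have h := (hB (ee K (1, 0)) (lam (ee K (1, 1)) • ee K (2, 2) + (-lam (ee K (2, 2))) • ee K (1, 1))).2.2
          rw [BB_IIb, h10, hb, hκB] at h
          simp at h
          exact h11 h

/-- **In characteristic two `S_3 = K[x]/(per_3)` is not factorial** (the crux's field `ℂ` — more
precisely `2 ≠ 0` — is load-bearing for the CRUX itself, not only for von zur Gathen's lemma):
`P = ker Φ = I₂(rows 1,2)/(per₃)` is a nonzero prime of height `≤ 1` (Stage 1) which is not principal
(Stage 3); in a UFD it would contain a prime element `q` (Kaplansky), and then `P = (q)`. [folklore] -/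
theorem not_ufm_S_three_charTwo : ¬ UniqueFactorizationMonoid (S K 3) := by
  intro hufm
  haveI : IsDomain (S K 3) := isDomain_S K (by norm_num)
  have hne : PD K (Tk 0) ≠ ⊥ := by
    intro h
    have hm := (mk_quad_mem_PD K).2.2
    rw [h, Ideal.mem_bot] at hm
    exact mk_mC_ne_zero K hm
  obtain ⟨q, hqP, hq⟩ := Ideal.IsPrime.exists_mem_prime_of_ne_bot (PD_isPrime K (Tk 0)) hne
  have hle : Ideal.span {q} ≤ PD K (Tk 0) := (Ideal.span_singleton_le_iff_mem _).mpr hqP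
  haveI : (Ideal.span {q}).IsPrime := (Ideal.span_singleton_prime hq.ne_zero).mpr hq
  rcases hle.lt_or_eq with hlt | heq
  · have h1 := Ideal.height_add_one_le_of_lt_of_isPrime hlt
    have h2 := height_PD_zero_le_one K
    have h3 : (Ideal.span {q}).height + 1 ≤ 1 := h1.trans h2
    have h4 : (Ideal.span {q}).height = 0 := by
      have hfin : (Ideal.span {q}).height ≠ ⊤ := by
        intro ht
        rw [ht, top_add] at h3
        exact absurd h3 (by decide)
      obtain ⟨k, hk⟩ := ENat.ne_top_iff_exists.mp hfin
      rw [← hk] at h3 ⊢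
      have : k + 1 ≤ 1 := by exact_mod_cast h3
      have hk0 : k = 0 := by omega
      simp [hk0]
    have h5 : Ideal.span {q} = ⊥ := Ideal.height_eq_zero_iff_eq_bot.mp h4
    exact hq.ne_zero (Ideal.span_singleton_eq_bot.mp h5)
  · exact PD_zero_ne_span_singleton K q heq.symm


/-- The crux's statement over an arbitrary field `K` (the crux is the case `K = ℂ`). [folklore] -/
def PermHypersurfaceFactorialOver (K : Type*) [Field K] : Prop :=
  ∀ n : ℕ, 3 ≤ n → ∀ P : Ideal (S K n), P.IsPrime → P.height = 1 → P.IsPrincipal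

/-- **The field is load-bearing: over any field of characteristic two the crux's statement is
FALSE** (already at `n = 3`; `per₃ = det₃` and `Cl(K[x]/(det₃)) ≠ 0`, witnessed by the
non-principal height-one prime `I₂(rows 1,2)/(det₃)` — Bruns–Vetter's generator of `Cl = ℤ`).
Consistent with `Literature.Barriers.ValiantsHypothesis.PermanentCharTwo`. [folklore] -/
theorem permHypersurfaceFactorialOver_false_of_charTwo : ¬ PermHypersurfaceFactorialOver K := by
  intro h
  haveI : IsDomain (S K 3) := isDomain_S K (by norm_num)
  exact not_ufm_S_three_charTwo K
    (UniqueFactorizationMonoid.iff_forall_isPrincipal_of_height_eq_one.mpr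
      fun P hP hh => h 3 le_rfl P hP hh)

/-- Concretely: `𝔽₂[x_{3×3}]/(per₃)` is not a UFD. [folklore] -/
example : ¬ UniqueFactorizationMonoid (S (ZMod 2) 3) := not_ufm_S_three_charTwo (ZMod 2)

end CharTwoNotUFD2


end Summit.ValiantsHypothesis.ValiantsHypothesis.Cruxes.PermHypersurfaceFactorial.Disproof
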